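import Literature.Computability.AlgebraicComplexity.BI17GenericTensorDegreeMonoidProofs
import Literature.Computability.AlgebraicComplexity.QuantumFunctionalsDegenerationProofs
import Literature.Computability.AlgebraicComplexity.BLMW11DetStabilizerInvariantsProofs
import Literature.NumberTheory.DiophantineGeometry.KroneckerTriplePoly
import Literature.NumberTheory.DiophantineGeometry.KroneckerPointSets
import Literature.RepresentationTheory.FiniteGroups.SymmetricGroupCharacterEvaluation
import Literature.Computability.AlgebraicComplexity.BI17FundamentalTensorInvariantProofs
import Literature.RepresentationTheory.GeneralLinear.WordModelIsotypicSpan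
import HarnessLib

/-!
# `dim O(⊗³ℂ^m)^{SL³_m}_{mδ} = k_m(δ)`, `E(m) = {mδ : k_m(δ) > 0}`, Thm. 5.9, and `F_n ≠ 0` (Thm. 5.13)
# (Bürgisser–Ikenmeyer 2017, §5: the dimension formula, eq. (5.2), `k_{n²}(n) = 1`, Thm. 5.13, Rem. 5.14) — PROOFS

P. Bürgisser, C. Ikenmeyer, *Fundamental invariants of orbit closures*, J. Algebra **477** (2017)
390–434 = arXiv:1511.02927 [BurgisserIkenmeyer2017], §5 (TeX `main.tex` L2005–2031; held text
`paper:arxiv-1511.02927` p0018): "It is a well-known fact, e.g., see [Landsberg–Manivel 2004], that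
`dim O(⊗³ℂ^m)^{SL³_m}_{mδ} = k(m × δ, m × δ, m × δ) =: k_m(δ)` … As a consequence of the above, we
obtain `E'(m) = {δ ∈ ℕ | k_m(δ) > 0}` (5.2)". THEOREMS, plus the plumbing definitions of §9–§10
(block structures and block signs; no named fact); sibling of the statement file
`BI17FundamentalInvariantTensors.lean` (cell `val-lit`, row BI2017-B), three of whose named facts are
DISCHARGED here:

* `BI2017_dim_sl3Invariants_holds : BI2017_dim_sl3Invariants` — the dimension formula, from
  `finrank_sl3InvariantsOfDegree_eq_kronRect` (any field of characteristic zero, every `m`);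
* `BI2017_eq_5_2_holds : BI2017_eq_5_2` — `E(m) = {mδ : k_m(δ) > 0}` (typed through `E(m)`; the
  print's `m > 2` only serves `a(m) = 1`; proved for every `m`,
  `genericTensorDegreeMonoid_eq_kronRect`), from the dimension formula and `E(m) ⊆ mℕ`
  (`dvd_of_mem_sl3InvariantsOfDegree_of_ne_zero`, read off the word model: the support of a
  unimodular-Borel invariant has constant content; the tree's `card_dvd_of_mem_genericTensorDegreeMonoid`
  of `BI17TensorDegreeMonoidDivisibilityProofs.lean` is the same statement over `ℂ` via a root of unity);
* `BI2017_thm_5_13_holds : BI2017_thm_5_13` — **Thm. 5.13** (L2266, p0020), "`F_n((g_1 ⊗ g_2 ⊗ g_3)w)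
  = (det g_1 det g_2 det g_3)^n F_n(w)` … Moreover, `F_n ≠ 0`": the semi-invariance is the tree's
  `fundInvariantTensor_tensorChi_pow` (`BI17FundamentalTensorInvariantProofs`, reduction
  `BI2017_thm_5_13_of_ne_zero`), and §10 proves `fundInvariantTensor_ne_zero : F_n ≠ 0` (every `n`)
  by the printed "rather indirect" proof (below), together with `exists_eq_smul_fundInvariantTensor`
  ("this vector space is at most 1-dimensional with `F_n` being the only element up to scale":
  `O(⊗³ℂ^{n²})^{SL³}_{n³} = ℂ F_n`) and `cube_mem_genericTensorDegreeMonoid` (`n³ ∈ E(n²)`);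
* Rem. 5.14 (noncubic formats, L2349, p0021), the Kronecker clause "We know from [Ike12b] that
  `k(n₂n₃ × n₁, n₁n₃ × n₂, n₁n₂ × n₃) = 1`" — `kroneckerCoeff_brick_eq_one` (§11, PROVED for all
  `n₁, n₂, n₃`, the three rectangles taken in a common `Nat.Partition n` through their parts), by the
  point-set bounds of §6 run for the brick `[n₁] × [n₂] × [n₃]` instead of the cube; the invariant
  `F_{n₁n₂n₃}` of the remark is not typed;

and BI 2017, **Thm. 5.9** (L2122, p0019) is proved up to one input (§6–§7):

* (3) `k_{n²}(n) = 1` — `kronRect_sq_eq_one` (every `n`, any field of characteristic zero), and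
  `e(n²) = n³` — `BI2017_thm_5_9_part3_minimalDegree` (`n ≥ 1`);
* (1) `m ∣ e(m)` and `⌈√m⌉ ≤ e'(m)`, i.e. `m ≤ (e(m)/m)²`, GIVEN `e(m) > 0` —
  `BI2017_thm_5_9_part1_of_pos`, from `k_m(δ) = 0` for `0 < δ`, `δ² < m` (`kronRect_eq_zero_of_sq_lt`);
* the assembly `BI2017_thm_5_9_of_pos_of_alonTarsi`: the named fact `BI2017_thm_5_9` follows from
  the positivity of `e(m)` for `m > 2` (a non-constant `SL³_m`-invariant exists on `⊗³ℂ^m`; implicit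
  in print, where `e'(m)` "is the minimum `δ` such that `k_m(δ) > 0`"; NOT proved in the tree) and
  its Alon–Tarsi clause (2).
* (2) "`e'(m) ≤ m` if the Alon–Tarsi conjecture holds for `m`", typed `♯CELS(m) ≠ ♯COLS(m) ⇒
  e(m) ≤ m²` — `BI2017_thm_5_9_part2` (§9, PROVED, `m ≥ 1`), so that `BI2017_thm_5_9_of_pos` reduces
  the named fact to the positivity of `e(m)` (`m > 2`) ALONE. §9 follows the printed proof in the
  word model: BI's `ζ ⊗ ζᵗ ⊗ ζᵗ`, `ζ = (e_1 ∧ ⋯ ∧ e_m)^{⊗m}`, is the triple tensor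
  `latinSquareTensor` = (column-block sign) ⊗ (row-block sign) ⊗ (row-block sign) of words on `m²`
  positions (`wordBlockSign`, for a general block structure `Fin D ≃ Fin b × Fin N`; §9's
  definitions, with the block structures `rowBlocks`/`colBlocks`), each block sign being a `GL_m`-semi-invariant of weight `det^m`
  (`wordRep_wordBlockSign`: "each contraction … is a product of determinants"), its symmetrisation
  lies in `symTripleHw □ □ □` (`□ = m × m`), and its diagonal trace is
  `(m²)! · (♯CELS(m) − ♯COLS(m))` (`sum_latinSquareTensor_diag`: "the numbers `i_{1,1},…,i_{m,m}`
  must form a Latin square … the product of the signs of the permutations in the columns";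
  `Kumar2015.latinColCount`), whence `k_m(m) > 0` and `m² ∈ E(m)` under `AT(m)`.
* Examples 5.5 / 5.6 (§8), the kernel-checkable part: `E(3) = {3δ : δ ≠ 1}`
  (`BI2017_ex_5_5_degreeMonoid`; "1 is the only gap of `E'(3)`": `k_3(1) = 0` by the bound, `k_3(2)`,
  `k_3(3) > 0` by the tree's Murnaghan–Nakayama evaluator `MNEval.kronSum` in the kernel, then the
  semigroup property), `E(4) = {4δ : δ ≠ 1}` (`BI2017_ex_5_6_degreeMonoid_four`), `e(3) = 6`,
  `e(4) = 8`, `e(5) = 15`, `e(6) = 18`, `e(8) = 24`, `e(9) = 27`, `e(16) = 64` (`BI2017_ex_5_6_three/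
  _four/_five/_six/_eight/_nine/_sixteen`; the non-square ones through kernel certificates `k_5(3)`,
  `k_6(3)`, `k_8(3) > 0` in `S_15`, `S_18`, `S_24` and the bound), `k_4(2) = k_9(3) = k_16(4) = 1`
  (`BI2017_rem_5_18_squares`). The SCHUR/DERKSEN tables of `BI2017_ex_5_5`/`BI2017_ex_5_6` beyond
  these entries are not reproduced (`e'(7) = 4` needs `S_28`, out of the kernel's reach; the named facts
  stay).

## Proof (ours; the print cites Schur–Weyl duality via Landsberg–Manivel)

The tree already holds both halves of a Schur–Weyl-free argument; this file is the dictionary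
between them.

* WORD MODEL (`Literature.NumberTheory.DiophantineGeometry.KroneckerTriplePoly`, Manivel 2011 /
  Ikenmeyer–Panova 2017 §1.1): `g(λ, μ, ν) = dim symTripleHw λ μ ν` (`finrank_symTripleHw`), the
  `S_n`-symmetric functions `M` on triples of words all of whose partial functions are
  highest-weight vectors (Borel semi-invariants) of `(k^N)^{⊗n}`; the polynomial `P_M = triplePoly M`
  and the symmetric array `tripleArr` are inverse bijections with forms of degree `n` in the
  variables `X_{((a,b),c)}` (`triplePoly_tripleArr`, `tripleArr_triplePoly`), intertwining the leg
  actions `legActᵢ g` with the linear substitutions `legSubstᵢ g` (`triplePoly_legActᵢ`).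
* RECTANGULAR WEIGHT ⇒ `SL`-INVARIANCE (`BLMW11DetStabilizerInvariantsProofs.lean`, t08; BLMW 2011
  proof of Prop. 5.2.1, Fulton–Harris §15.5 `𝕊_{(δ,…,δ)} = det^δ`): on `HW_□((k^m)^{⊗mδ})`,
  `□ = (δ,…,δ)` = the unimodular-Borel invariants (`unimodularBorelInvariants_eq_highestWeightSpace`),
  ALL of `GL_m` acts by `det^δ` (`wordRep_eq_det_pow_smul_of_mem_unimodularBorelInvariants`, proved
  infinitesimally through root subgroups).
* THIS FILE. §1: evaluation at a transformed tensor is evaluation of a substituted form,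
  `F((Gᵀ ⊗ 1 ⊗ 1)w) = (legSubst₁ G F)(w)` (after reindexing BI's variables `Fin m × (Fin m × Fin m)`
  to the dictionary's `(Fin m × Fin m) × Fin m` along `Equiv.prodAssoc`), and the two other legs.
  §2: for `M ∈ HW_□^{⊗3}` every leg acts by `det^δ`, so `P_M` is fixed by the unimodular leg
  substitutions and (§1, `(g₁ ⊗ g₂ ⊗ g₃) = (g₁ ⊗ 1 ⊗ 1)(1 ⊗ g₂ ⊗ 1)(1 ⊗ 1 ⊗ g₃)`) its reindexing is
  `IsSL3Invariant`, homogeneous of degree `mδ`. §3: conversely, for `F ∈ O(⊗³k^m)^{SL³}_{mδ}` the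
  evaluation identities of `IsSL3Invariant` are polynomial identities (`MvPolynomial.funext`, `k`
  infinite), so the unimodular leg substitutions fix (the reindexed) `F`, hence the unimodular leg
  actions fix its symmetric array `tripleArr F` (injectivity of `P` on symmetric tensors), i.e. all
  partial functions are unimodular-Borel invariants = `HW_□`-vectors: `tripleArr F ∈ symTripleHw □ □ □`.
  §4: the two maps are inverse and `k`-linear — a linear equivalence
  `O(⊗³k^m)^{SL³_m}_{mδ} ≃ symTripleHw □ □ □` (`exists_linearEquiv_sl3InvariantsOfDegree_symTripleHw`),
  so `dim = g(□, □, □) = kronRect k m δ` (`□` has `≤ m` parts). §5: the two facts over `ℂ`.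
* §6 (Thm. 5.9 (1), (3) on the Kronecker side; print: "`k(λ,μ,ν) = 0` if `ℓ(λ) > ℓ(μ)ℓ(ν)`" and the
  complement symmetry of [Ike12b]; Rem. 5.10: "also immediately follows combinatorially from the
  upper and lower bounds in [Man:97] and [BI:13], see also [IMW:15]" — we follow Rem. 5.10 with the
  tree's Ikenmeyer–Mulmuley–Walter point sets, `KroneckerPointSets.lean`): `k_m(δ) > 0`, `δ > 0`,
  yields an `mδ`-point SET of `ℕ³` inside `[0,δ)³`, so `m ≤ δ²` (`le_sq_of_kronRect_pos`); the cube
  `[0,n)³` is a pyramid with the marginals of three `n² × n` rectangles, so `k_{n²}(n) > 0`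
  (`kronRect_sq_pos`); and `k_{n²}(n) = k((n²)ⁿ,(n²)ⁿ, n² × n)` is the dimension of the ANTI-invariant
  triple tensors in `HW_{(n²)ⁿ}^{⊗3}` on `n³` positions over `[0,n)`
  (`finrank_invariants_signTwist_tripleHwRep`), which are determined by one value since a
  configuration in their support is a bijection onto the `n³` letter triples
  (`eq_zero_of_antiInvariant_of_apply_eq_zero`), so `k_{n²}(n) ≤ 1` (`kronRect_sq_le_one`).
* §7: `e(n²) = n³`, part (1) given `e(m) > 0`, and the assembly, through §5's
  `E(m) = {mδ : k_m(δ) > 0}`.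
* §10 (Thm. 5.13, `F_n ≠ 0`; print p0020: "The proof is rather indirect … By Schur–Weyl duality, the
  `S_d³`-representation `(⊗^d(⊗³ℂ^m))^{SL³_m}` is irreducible … generated by `{πP ∣ π ∈ S_d³}`",
  `P = ζ ⊗ ζ ⊗ ζ`, `ζ = (⋀_{i=1}^m e_i)^{⊗n}`; wedge lists, blocks, `P_t`; "If there exist two numbers
  `i` and `j` whose block coincides in the first wedge list of `t` and … in the second and third wedge
  list, then `P_t` vanishes under the projection `Ψ := (1/d!) ∑_{σ ∈ S_d} σ` … We call this the zero
  pattern"; "these triples all coincide up to the action of `S_d` … the point set is precisely the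
  `n × n × n` cube"; "`(Ψ(P_t))(w) = F_n(w)`. With Proposition 5.9 (3) it follows that `F_n ≠ 0`").
  In the word model (`N = n²` letters, `d = n³` positions): a WEDGE LIST is a block structure
  `e : Fin d ≃ Fin n × Fin N` and `ζ_e = wordBlockSign e ∈ HW_□` (§9, now for general block
  structures), `P_t = blockSignTriple e₁ e₂ e₃ ∈ HW_□^{⊗3}` (`tripleHw`), the cube's slices are the
  block structures `xSliceBlocks/ySliceBlocks/zSliceBlocks` of the fixed ordering `cubePos`, and eq. (5.5) reads
  `F_n = P_{ζ_x ⊗ ζ_y ⊗ ζ_z}` (`fundInvariantTensor_eq_rename_triplePoly`; `cubeSignTensor`). STEP 1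
  (generation): `HW_□` is an irreducible `S_d`-module (the tree's `isIrreducible_hwPermRep`, which is
  the Schur–Weyl input `HW_λ ≅ S^λ`) and the span of the `ζ_e` is a nonzero `S_d`-stable subspace
  (`σ · ζ_e = ζ_{σ⁻¹ e}`), hence all of `HW_□` (`highestWeightSpace_rectangle_le_span_wordBlockSign`);
  so `HW_□^{⊗3}` is spanned by the `P_t` (slice spaces are images of tensor products,
  `exists_sliceMap_eq`). STEP 2 (zero pattern): a swap of two positions in a common block of all
  three lists changes the sign of each factor (`wordBlockSign_comp_swap`), so `Ψ(P_t) = −Ψ(P_t) = 0`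
  (`sym3_blockSignTriple_eq_zero_of_zeroPattern`). STEP 3 (point sets): without the zero pattern
  the map position `↦` (its three blocks) is injective into `[n)³`, hence bijective (`d = n³`), a
  renaming `ρ ∈ S_d` carrying the blocks of `eᵢ` to the slices, and `P_t = ± ρ · P_{t₀}`
  (`wordBlockSign_eq_smul_of_blocks_eq`: re-ordering inside blocks costs a sign;
  `blockSignTriple_eq_smul_cubeSignTensor_of_injective`). STEP 4: if `Ψ(P_{t₀}) = 0` then `Ψ`
  kills `HW_□^{⊗3} ⊇ symTripleHw □ □ □`, where `Ψ = d!`; but `dim symTripleHw □ □ □ = k_{n²}(n) = 1`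
  (§6). So `Ψ(P_{t₀}) ≠ 0` (`sym3_cubeSignTensor_ne_zero`), `P_{Ψ P_{t₀}} = d! P_{t₀} ≠ 0`
  (injectivity of `P` on symmetric tensors), `F_n ≠ 0`.

Honest framing: a classical invariant-theory computation, typed-literature bookkeeping for the cell
`val-lit`; VP ≠ VNP is NOT proved and nothing here is progress on it.

## References

* [BurgisserIkenmeyer2017] P. Bürgisser, C. Ikenmeyer, J. Algebra 477 (2017) 390–434 =
  arXiv:1511.02927, §5, the paragraph before eq. (5.2) and eq. (5.2) (p0018).
* J. M. Landsberg, L. Manivel, *On the ideals of secant varieties of Segre varieties*, Found.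
  Comput. Math. 4 (2004) 397–422 (the "well-known fact" as cited in print).
* L. Manivel, J. Algebraic Combin. 33 (2011) 153–162, §3.4; C. Ikenmeyer, G. Panova, Adv. Math. 319
  (2017) §1.1 (Kronecker coefficients as dimensions of highest-weight spaces) [Manivel2011,
  IkenmeyerPanova2017].
* [BurgisserEtAl2011] P. Bürgisser, J. M. Landsberg, L. Manivel, J. Weyman, SIAM J. Comput. 40
  (2011), proof of Prop. 5.2.1 (`(S_μE)^{SL(E)} ≠ 0` only for `μ = (δⁿ)`).
* [FultonHarrisGTM129] W. Fulton, J. Harris, GTM 129, §15.3, §15.5.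
* [IkenmeyerMulmuleyWalter2017] C. Ikenmeyer, K. D. Mulmuley, M. Walter, comput. complexity 26
  (2017), §2 (point sets, pyramids, Lemma 2.3). L. Manivel, *On rectangular Kronecker coefficients*
  / *Applications de Gauss et pléthysme*, and P. Bürgisser, C. Ikenmeyer, STOC 2013 [BI:13], as cited
  in Rem. 5.10.
* For Thm. 5.13: P. Bürgisser, C. Ikenmeyer, *Explicit lower bounds via geometric complexity
  theory*, STOC 2013, Ex. 4.12, and C. Ikenmeyer, PhD thesis, Paderborn 2012 ("obstruction
  designs"), as cited in the printed proof ("[BI:13]", "[Ike12b]").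

## Tree / Mathlib

Tree: `KroneckerTriplePoly` (`Alpha`, `triplePoly`, `tripleArr`, `triplePoly_tripleArr`,
`tripleArr_triplePoly`, `tripleArr_permute3`, `tripleArr_add/_smul`, `legActᵢ`, `legSubstᵢ`,
`triplePoly_legActᵢ`, `legActᵢ_permute3`, `eq_of_triplePoly_eq`, `isHomogeneous_triplePoly`,
`symTripleHw`, `mem_symTripleHw_iff`, `finrank_symTripleHw`), `KroneckerSemigroup` (`tripleHw`,
`mem_tripleHw_iff`, `Word3`), `DetStabilizerKronecker` (`unimodularBorelInvariants`),
`SchurWeylPlethysmKroneckerBoundProofs` (`unimodularBorelInvariants_eq_highestWeightSpace`,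
`Nat.Partition.card_parts_rectangle_le`), `BLMW11DetStabilizerInvariantsProofs`
(`wordRep_eq_det_pow_smul_of_mem_unimodularBorelInvariants`), `BI17FundamentalInvariantTensors`
(`IsSL3Invariant`, `sl3InvariantsOfDegree`, `mem_sl3InvariantsOfDegree_iff`, `tensorPt`, `kronRect`,
`genericTensorDegreeMonoid`, the two facts), `QuantumFunctionals(DegenerationProofs)` (`actTensor`,
`actTensor_apply`, `actTensor_actTensor`), `TensorWordModel` (`wordContent`, `sum_wordContent`),
`SchurWeylPlethysmKroneckerBoundProofs` (`wordContent_eq_of_mem_unimodularBorelInvariants`), `KroneckerPointSets` (`HasMarginals`,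
`HasMarginals.card_eq`, `exists_hasMarginals_of_kroneckerCoeff_pos`, `kroneckerCoeff_pos_of_isPyramid`,
`finrank_invariants_signTwist_tripleHwRep`, `zip3_injective_of_antiInvariant_of_ne_zero`),
`DiscreteTomography` (`IsPyramid`, `xMarginal`), `OccurrenceObstructionsIP` (`mem_youngDiagram_rectangle`,
`transpose_rectangle_parts`), `SymmetricGroupRepsSignTwist` (`signTwist`, `kroneckerCoeff_transpose₁₂`),
`SymmetricGroupCharacterEvaluation` (`MNEval.kronSum`, `kroneckerCoeff_pos_iff_kronSum_pos`), `KroneckerPointSets`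
(`kroneckerCoeff_pos_of_getD_add`, `kroneckerCoeff_pos_of_size_zero`). Mathlib: `MvPolynomial.funext`, `aeval_rename`,
`comp_aeval_apply`, `rename_rename`, `rename_injective`, `IsHomogeneous.rename_isHomogeneous`,
`Matrix.GeneralLinearGroup.mkOfDetNeZero`, `Matrix.det_transpose`, `LinearEquiv.finrank_eq`,
`Module.Finite.equiv`, `Module.finrank_pos_iff`, `Submodule.nontrivial_iff_ne_bot`. For §10:
`BI17FundamentalTensorInvariantProofs` (`fundInvariantTensor`, `labelSignX/Y/Z`, `xSliceMap` &c.,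
`BI2017_thm_5_13_of_ne_zero`, `fundInvariantTensor_mem_sl3InvariantsOfDegree`,
`cube_mem_genericTensorDegreeMonoid_of_ne_zero`), `WordModelIsotypicSpan` (`isIrreducible_hwPermRep`),
`WordHighestWeightSpecht` (`hwPermRep`, `coe_hwPermRep_apply`), `SliceRepresentation`
(`sliceSubmodule`, `exists_sliceMap_eq`, `sliceMap_tmul`), `KroneckerSemigroup` (`sym3`, `permute3`,
`permute3_mul`, `sym3_permute3`, `sym3_comp_zip3_symm`, `wordPoly_symFun`), `KroneckerTriplePoly`
(`eq_zero_of_triplePoly_eq_zero`), `TensorWordModel` (`wordPerm`, `wordPerm_apply`),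
`KumarLatinRectangles` (`Kumar2015.seqSign_comp_perm`, `seqSign_coe_perm`); Mathlib `Subrepresentation`,
`Representation.IsIrreducible` (`IsSimpleOrder.eq_bot_or_eq_top`), `Submodule.map₂_span_span`,
`Submodule.apply_mem_map₂`, `LinearMap.mk₂`, `Submodule.map_span`, `finrank_eq_one_iff_of_nonzero'`,
`CharZero.neg_eq_self_iff`, `Fintype.bijective_iff_injective_and_card`, `TensorProduct.induction_on`.
-/

noncomputable section

open MvPolynomial

namespace Literature.Computability.AlgebraicComplexity

open _root_.Literature.NumberTheory.DiophantineGeometry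
open _root_.Literature.Combinatorics.Enumerative.Tomography

/-! ### §1 Evaluation at a transformed tensor = evaluation of a substituted form -/

section EvalSubst

variable {k : Type*} [Field k] {m : ℕ}

/-- `((Gᵀ ⊗ 1 ⊗ 1)w)_{abc} = ∑_l G_{l a} w_{l b c}` (plumbing). [folklore] -/
private theorem actTensor_transpose_one_one_apply (G : Matrix (Fin m) (Fin m) k)
    (w : Fin m → Fin m → Fin m → k) (a b c : Fin m) :
    actTensor G.transpose (1 : Matrix (Fin m) (Fin m) k) (1 : Matrix (Fin m) (Fin m) k) w a b c =
      ∑ l, G l a * w l b c := by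
  simp only [actTensor_apply, Matrix.transpose_apply, Matrix.one_apply, mul_ite, mul_one, mul_zero,
    ite_mul, zero_mul, Finset.sum_ite_eq, Finset.mem_univ, if_true]

/-- `((1 ⊗ Gᵀ ⊗ 1)w)_{abc} = ∑_l G_{l b} w_{a l c}` (plumbing). [folklore] -/
private theorem actTensor_one_transpose_one_apply (G : Matrix (Fin m) (Fin m) k)
    (w : Fin m → Fin m → Fin m → k) (a b c : Fin m) :
    actTensor (1 : Matrix (Fin m) (Fin m) k) G.transpose (1 : Matrix (Fin m) (Fin m) k) w a b c =
      ∑ l, G l b * w a l c := by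
  simp only [actTensor_apply, Matrix.transpose_apply, Matrix.one_apply, mul_ite, mul_one, mul_zero,
    ite_mul, zero_mul, one_mul, Finset.sum_ite_irrel, Finset.sum_const_zero, Finset.sum_ite_eq,
    Finset.mem_univ, if_true]

/-- `((1 ⊗ 1 ⊗ Gᵀ)w)_{abc} = ∑_l G_{l c} w_{a b l}` (plumbing). [folklore] -/
private theorem actTensor_one_one_transpose_apply (G : Matrix (Fin m) (Fin m) k)
    (w : Fin m → Fin m → Fin m → k) (a b c : Fin m) :
    actTensor (1 : Matrix (Fin m) (Fin m) k) (1 : Matrix (Fin m) (Fin m) k) G.transpose w a b c =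
      ∑ l, G l c * w a b l := by
  simp only [actTensor_apply, Matrix.transpose_apply, Matrix.one_apply, mul_ite, mul_one, mul_zero,
    ite_mul, zero_mul, one_mul, Finset.sum_ite_irrel, Finset.sum_const_zero, Finset.sum_ite_eq,
    Finset.mem_univ, if_true]

/-- **Evaluation ↔ substitution, first leg**: `F((Gᵀ ⊗ 1 ⊗ 1)w) = (legSubst₁ G F)(w)` for a form
`F` in the dictionary's variables, read on tensors through `Equiv.prodAssoc` (the action of `GL(E)`
on `Sym(E ⊗ F ⊗ G)` as a substitution; BI 2017 §5 "`O(⊗³ℂ^m)`", L2005; step of the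
identification of `O(⊗³ℂ^m)^{SL³_m}` with the dictionary's semi-invariant forms).
[cite: BurgisserIkenmeyer2017, §5 eq. (5.1)] -/
theorem aeval_tensorPt_actTensor_fst (G : Matrix (Fin m) (Fin m) k) (w : Fin m → Fin m → Fin m → k)
    (F : MvPolynomial (Alpha m) k) :
    aeval (tensorPt (actTensor G.transpose (1 : Matrix (Fin m) (Fin m) k) (1 : Matrix (Fin m) (Fin m) k) w))
        (rename (Equiv.prodAssoc (Fin m) (Fin m) (Fin m)) F) =
      aeval (tensorPt w) (rename (Equiv.prodAssoc (Fin m) (Fin m) (Fin m)) (legSubst₁ m G F)) := by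
  rw [aeval_rename, aeval_rename, legSubst₁, comp_aeval_apply]
  congr 1
  refine MvPolynomial.algHom_ext fun x => ?_
  simp only [aeval_X, Function.comp_apply, Equiv.prodAssoc_apply, tensorPt, map_sum, map_smul,
    smul_eq_mul, actTensor_transpose_one_one_apply]

/-- **Evaluation ↔ substitution, second leg**: `F((1 ⊗ Gᵀ ⊗ 1)w) = (legSubst₂ G F)(w)`
(step of the identification of BI's `O(⊗³ℂ^m)^{SL³_m}` with the dictionary's semi-invariant forms).
[cite: BurgisserIkenmeyer2017, §5 eq. (5.1)] -/
theorem aeval_tensorPt_actTensor_snd (G : Matrix (Fin m) (Fin m) k) (w : Fin m → Fin m → Fin m → k)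
    (F : MvPolynomial (Alpha m) k) :
    aeval (tensorPt (actTensor (1 : Matrix (Fin m) (Fin m) k) G.transpose (1 : Matrix (Fin m) (Fin m) k) w))
        (rename (Equiv.prodAssoc (Fin m) (Fin m) (Fin m)) F) =
      aeval (tensorPt w) (rename (Equiv.prodAssoc (Fin m) (Fin m) (Fin m)) (legSubst₂ m G F)) := by
  rw [aeval_rename, aeval_rename, legSubst₂, comp_aeval_apply]
  congr 1
  refine MvPolynomial.algHom_ext fun x => ?_
  simp only [aeval_X, Function.comp_apply, Equiv.prodAssoc_apply, tensorPt, map_sum, map_smul,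
    smul_eq_mul, actTensor_one_transpose_one_apply]

/-- **Evaluation ↔ substitution, third leg**: `F((1 ⊗ 1 ⊗ Gᵀ)w) = (legSubst₃ G F)(w)`
(step of the identification of BI's `O(⊗³ℂ^m)^{SL³_m}` with the dictionary's semi-invariant forms).
[cite: BurgisserIkenmeyer2017, §5 eq. (5.1)] -/
theorem aeval_tensorPt_actTensor_thd (G : Matrix (Fin m) (Fin m) k) (w : Fin m → Fin m → Fin m → k)
    (F : MvPolynomial (Alpha m) k) :
    aeval (tensorPt (actTensor (1 : Matrix (Fin m) (Fin m) k) (1 : Matrix (Fin m) (Fin m) k) G.transpose w))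
        (rename (Equiv.prodAssoc (Fin m) (Fin m) (Fin m)) F) =
      aeval (tensorPt w) (rename (Equiv.prodAssoc (Fin m) (Fin m) (Fin m)) (legSubst₃ m G F)) := by
  rw [aeval_rename, aeval_rename, legSubst₃, comp_aeval_apply]
  congr 1
  refine MvPolynomial.algHom_ext fun x => ?_
  simp only [aeval_X, Function.comp_apply, Equiv.prodAssoc_apply, tensorPt, map_sum, map_smul,
    smul_eq_mul, actTensor_one_one_transpose_apply]

end EvalSubst

/-! ### §2 The word side: rectangular triple highest-weight tensors give `SL³`-invariant forms -/

section WordSide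

variable (k : Type*) [Field k] [CharZero k] {m δ : ℕ}

/-- **For `M ∈ HW_□ ⊗ HW_□ ⊗ HW_□` (`□ = (δ,…,δ)`, `m` parts) the first leg action of ANY
`g ∈ GL_m` is multiplication by `det(g)^δ`**: the partial functions are unimodular-Borel invariants
(`unimodularBorelInvariants_eq_highestWeightSpace`) on which `GL_m` acts by `det^δ`
(`wordRep_eq_det_pow_smul_of_mem_unimodularBorelInvariants`; BLMW 2011, proof of Prop. 5.2.1:
"`S_{(δⁿ)}E` is the one-dimensional representation `det^δ`"). [cite: BurgisserEtAl2011, Prop. 5.2.1 (proof)] -/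
theorem legAct₁_eq_det_pow_smul_of_mem_tripleHw_rectangle {M : Word3 m (m * δ) → k}
    (hM : M ∈ tripleHw k m (m * δ) (Weight.ofPartition m (Nat.Partition.rectangle m δ))
      (Weight.ofPartition m (Nat.Partition.rectangle m δ))
      (Weight.ofPartition m (Nat.Partition.rectangle m δ))) (g : GL (Fin m) k) :
    legAct₁ g M = ((g : Matrix (Fin m) (Fin m) k).det ^ δ) • M := by
  funext t
  obtain ⟨h1, -, -⟩ := (mem_tripleHw_iff _ _ _ M).1 hM
  have hy : (fun u => M ((u, t.1.2), t.2)) ∈ unimodularBorelInvariants k m (m * δ) := by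
    rw [unimodularBorelInvariants_eq_highestWeightSpace]; exact h1 t.1.2 t.2
  exact congrFun (wordRep_eq_det_pow_smul_of_mem_unimodularBorelInvariants k hy g) t.1.1

/-- Second leg: `g ·₂ M = det(g)^δ M` on `HW_□^{⊗3}`. [cite: BurgisserEtAl2011, Prop. 5.2.1 (proof)] -/
theorem legAct₂_eq_det_pow_smul_of_mem_tripleHw_rectangle {M : Word3 m (m * δ) → k}
    (hM : M ∈ tripleHw k m (m * δ) (Weight.ofPartition m (Nat.Partition.rectangle m δ))
      (Weight.ofPartition m (Nat.Partition.rectangle m δ))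
      (Weight.ofPartition m (Nat.Partition.rectangle m δ))) (g : GL (Fin m) k) :
    legAct₂ g M = ((g : Matrix (Fin m) (Fin m) k).det ^ δ) • M := by
  funext t
  obtain ⟨-, h2, -⟩ := (mem_tripleHw_iff _ _ _ M).1 hM
  have hy : (fun v => M ((t.1.1, v), t.2)) ∈ unimodularBorelInvariants k m (m * δ) := by
    rw [unimodularBorelInvariants_eq_highestWeightSpace]; exact h2 t.1.1 t.2
  exact congrFun (wordRep_eq_det_pow_smul_of_mem_unimodularBorelInvariants k hy g) t.1.2

/-- Third leg: `g ·₃ M = det(g)^δ M` on `HW_□^{⊗3}`. [cite: BurgisserEtAl2011, Prop. 5.2.1 (proof)] -/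
theorem legAct₃_eq_det_pow_smul_of_mem_tripleHw_rectangle {M : Word3 m (m * δ) → k}
    (hM : M ∈ tripleHw k m (m * δ) (Weight.ofPartition m (Nat.Partition.rectangle m δ))
      (Weight.ofPartition m (Nat.Partition.rectangle m δ))
      (Weight.ofPartition m (Nat.Partition.rectangle m δ))) (g : GL (Fin m) k) :
    legAct₃ g M = ((g : Matrix (Fin m) (Fin m) k).det ^ δ) • M := by
  funext t
  obtain ⟨-, -, h3⟩ := (mem_tripleHw_iff _ _ _ M).1 hM
  have hy : (fun w => M (t.1, w)) ∈ unimodularBorelInvariants k m (m * δ) := by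
    rw [unimodularBorelInvariants_eq_highestWeightSpace]; exact h3 t.1.1 t.1.2
  exact congrFun (wordRep_eq_det_pow_smul_of_mem_unimodularBorelInvariants k hy g) t.2

/-- **The form `P_M` of `M ∈ HW_□^{⊗3}` is fixed by the unimodular substitutions in the first
index**: `legSubst₁ A P_M = P_M` for `det A = 1` (`P_{g ·₁ M} = g ·₁ P_M`, `triplePoly_legAct₁`;
the `SL(E)`-invariance of `S_{(δⁿ)}E = det^δ`). [cite: BurgisserEtAl2011, Prop. 5.2.1 (proof)] -/
theorem legSubst₁_triplePoly_of_det_eq_one {M : Word3 m (m * δ) → k}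
    (hM : M ∈ tripleHw k m (m * δ) (Weight.ofPartition m (Nat.Partition.rectangle m δ))
      (Weight.ofPartition m (Nat.Partition.rectangle m δ))
      (Weight.ofPartition m (Nat.Partition.rectangle m δ)))
    {A : Matrix (Fin m) (Fin m) k} (hA : A.det = 1) :
    legSubst₁ m A (triplePoly M) = triplePoly M := by
  have hA0 : A.det ≠ 0 := by rw [hA]; exact one_ne_zero
  have h := triplePoly_legAct₁ (Matrix.GeneralLinearGroup.mkOfDetNeZero A hA0) M
  rw [Matrix.GeneralLinearGroup.val_mkOfDetNeZero] at h
  rw [← h, legAct₁_eq_det_pow_smul_of_mem_tripleHw_rectangle k hM,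
    Matrix.GeneralLinearGroup.val_mkOfDetNeZero, hA, one_pow, one_smul]

/-- Second index: `legSubst₂ A P_M = P_M` for `det A = 1`, `M ∈ HW_□^{⊗3}`.
[cite: BurgisserEtAl2011, Prop. 5.2.1 (proof)] -/
theorem legSubst₂_triplePoly_of_det_eq_one {M : Word3 m (m * δ) → k}
    (hM : M ∈ tripleHw k m (m * δ) (Weight.ofPartition m (Nat.Partition.rectangle m δ))
      (Weight.ofPartition m (Nat.Partition.rectangle m δ))
      (Weight.ofPartition m (Nat.Partition.rectangle m δ)))
    {A : Matrix (Fin m) (Fin m) k} (hA : A.det = 1) :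
    legSubst₂ m A (triplePoly M) = triplePoly M := by
  have hA0 : A.det ≠ 0 := by rw [hA]; exact one_ne_zero
  have h := triplePoly_legAct₂ (Matrix.GeneralLinearGroup.mkOfDetNeZero A hA0) M
  rw [Matrix.GeneralLinearGroup.val_mkOfDetNeZero] at h
  rw [← h, legAct₂_eq_det_pow_smul_of_mem_tripleHw_rectangle k hM,
    Matrix.GeneralLinearGroup.val_mkOfDetNeZero, hA, one_pow, one_smul]

/-- Third index: `legSubst₃ A P_M = P_M` for `det A = 1`, `M ∈ HW_□^{⊗3}`.
[cite: BurgisserEtAl2011, Prop. 5.2.1 (proof)] -/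
theorem legSubst₃_triplePoly_of_det_eq_one {M : Word3 m (m * δ) → k}
    (hM : M ∈ tripleHw k m (m * δ) (Weight.ofPartition m (Nat.Partition.rectangle m δ))
      (Weight.ofPartition m (Nat.Partition.rectangle m δ))
      (Weight.ofPartition m (Nat.Partition.rectangle m δ)))
    {A : Matrix (Fin m) (Fin m) k} (hA : A.det = 1) :
    legSubst₃ m A (triplePoly M) = triplePoly M := by
  have hA0 : A.det ≠ 0 := by rw [hA]; exact one_ne_zero
  have h := triplePoly_legAct₃ (Matrix.GeneralLinearGroup.mkOfDetNeZero A hA0) M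
  rw [Matrix.GeneralLinearGroup.val_mkOfDetNeZero] at h
  rw [← h, legAct₃_eq_det_pow_smul_of_mem_tripleHw_rectangle k hM,
    Matrix.GeneralLinearGroup.val_mkOfDetNeZero, hA, one_pow, one_smul]

/-- **`HW_□ ⊗ HW_□ ⊗ HW_□ → O(⊗³k^m)^{SL³_m}`**: the polynomial `P_M` of a rectangular triple
highest-weight tensor, read in BI's variables `w_{abc}`, is `SL³`-invariant
(`F((g₁ ⊗ g₂ ⊗ g₃)w) = F(w)`, `gᵢ ∈ SL_m`), by `(g₁ ⊗ g₂ ⊗ g₃) = (g₁ ⊗ 1 ⊗ 1)(1 ⊗ g₂ ⊗ 1)(1 ⊗ 1 ⊗ g₃)`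
and the three evaluation ↔ substitution identities (BI 2017 §5, `O(⊗³ℂ^m)^{SL³_m}`, L2005).
[cite: BurgisserIkenmeyer2017, §5 eq. (5.1)] -/
theorem isSL3Invariant_rename_triplePoly {M : Word3 m (m * δ) → k}
    (hM : M ∈ tripleHw k m (m * δ) (Weight.ofPartition m (Nat.Partition.rectangle m δ))
      (Weight.ofPartition m (Nat.Partition.rectangle m δ))
      (Weight.ofPartition m (Nat.Partition.rectangle m δ))) :
    IsSL3Invariant (rename (Equiv.prodAssoc (Fin m) (Fin m) (Fin m)) (triplePoly M)) := by
  intro g₁ g₂ g₃ w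
  set G₁ : Matrix (Fin m) (Fin m) k := (g₁ : Matrix (Fin m) (Fin m) k) with hG₁
  set G₂ : Matrix (Fin m) (Fin m) k := (g₂ : Matrix (Fin m) (Fin m) k) with hG₂
  set G₃ : Matrix (Fin m) (Fin m) k := (g₃ : Matrix (Fin m) (Fin m) k) with hG₃
  have h : actTensor G₁ G₂ G₃ w =
      actTensor G₁.transpose.transpose (1 : Matrix (Fin m) (Fin m) k) (1 : Matrix (Fin m) (Fin m) k)
        (actTensor (1 : Matrix (Fin m) (Fin m) k) G₂.transpose.transpose (1 : Matrix (Fin m) (Fin m) k)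
          (actTensor (1 : Matrix (Fin m) (Fin m) k) (1 : Matrix (Fin m) (Fin m) k)
            G₃.transpose.transpose w)) := by
    rw [actTensor_actTensor, actTensor_actTensor]
    simp only [Matrix.mul_one, Matrix.one_mul, Matrix.transpose_transpose]
  have hd₁ : G₁.transpose.det = 1 := by rw [Matrix.det_transpose]; exact g₁.2
  have hd₂ : G₂.transpose.det = 1 := by rw [Matrix.det_transpose]; exact g₂.2
  have hd₃ : G₃.transpose.det = 1 := by rw [Matrix.det_transpose]; exact g₃.2
  rw [h, aeval_tensorPt_actTensor_fst, legSubst₁_triplePoly_of_det_eq_one k hM hd₁,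
    aeval_tensorPt_actTensor_snd, legSubst₂_triplePoly_of_det_eq_one k hM hd₂,
    aeval_tensorPt_actTensor_thd, legSubst₃_triplePoly_of_det_eq_one k hM hd₃]

/-- … hence `P_M ∈ O(⊗³k^m)^{SL³_m}_{mδ}` (`P_M` is a form of degree `mδ`).
[cite: BurgisserIkenmeyer2017, §5 eq. (5.1)] -/
theorem rename_triplePoly_mem_sl3InvariantsOfDegree {M : Word3 m (m * δ) → k}
    (hM : M ∈ tripleHw k m (m * δ) (Weight.ofPartition m (Nat.Partition.rectangle m δ))
      (Weight.ofPartition m (Nat.Partition.rectangle m δ))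
      (Weight.ofPartition m (Nat.Partition.rectangle m δ))) :
    rename (Equiv.prodAssoc (Fin m) (Fin m) (Fin m)) (triplePoly M) ∈
      sl3InvariantsOfDegree (Fin m) k (m * δ) := by
  rw [mem_sl3InvariantsOfDegree_iff]
  exact ⟨(isHomogeneous_triplePoly M).rename_isHomogeneous, isSL3Invariant_rename_triplePoly k hM⟩

end WordSide

/-! ### §3 The form side: `SL³`-invariant forms give rectangular triple highest-weight tensors -/

section FormSide

variable (k : Type*) [Field k] [CharZero k] {m δ : ℕ}

omit [Field k] [CharZero k] in
/-- Every point of the affine space `⊗³k^m` is a tensor: `x = tensorPt (curry x)` (plumbing).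
[folklore] -/
private theorem tensorPt_curry (x : Fin m × Fin m × Fin m → k) :
    tensorPt (fun a b c => x (a, b, c)) = x :=
  rfl

omit [CharZero k] in
/-- Reindexing back and forth (plumbing). [folklore] -/
private theorem rename_prodAssoc_rename_symm (F : MvPolynomial (Fin m × Fin m × Fin m) k) :
    rename (Equiv.prodAssoc (Fin m) (Fin m) (Fin m))
        (rename (Equiv.prodAssoc (Fin m) (Fin m) (Fin m)).symm F) = F := by
  rw [rename_rename, Equiv.self_comp_symm, rename_id_apply]

omit [CharZero k] in
/-- Reindexing forth and back (plumbing). [folklore] -/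
private theorem rename_symm_rename_prodAssoc (P : MvPolynomial (Alpha m) k) :
    rename (Equiv.prodAssoc (Fin m) (Fin m) (Fin m)).symm
        (rename (Equiv.prodAssoc (Fin m) (Fin m) (Fin m)) P) = P := by
  rw [rename_rename, Equiv.symm_comp_self, rename_id_apply]

/-- **Evaluation-invariance gives substitution-invariance, first leg**: for an `SL³`-invariant
`F` (BI's `IsSL3Invariant`: `F((g₁ ⊗ g₂ ⊗ g₃)w) = F(w)` for all tensors `w`) the reindexed form is
fixed by `legSubst₁ A`, `det A = 1` — two forms agreeing at every point of `⊗³k^m` are equal, `k`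
being infinite (`MvPolynomial.funext`); step of the identification of `O(⊗³ℂ^m)^{SL³_m}` (BI 2017
§5, (5.1)) with the dictionary's semi-invariant forms. [cite: BurgisserIkenmeyer2017, §5 eq. (5.1)] -/
theorem legSubst₁_rename_symm_eq_of_isSL3Invariant {F : MvPolynomial (Fin m × Fin m × Fin m) k}
    (hF : IsSL3Invariant F) {A : Matrix (Fin m) (Fin m) k} (hA : A.det = 1) :
    legSubst₁ m A (rename (Equiv.prodAssoc (Fin m) (Fin m) (Fin m)).symm F) =
      rename (Equiv.prodAssoc (Fin m) (Fin m) (Fin m)).symm F := by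
  apply rename_injective _ (Equiv.prodAssoc (Fin m) (Fin m) (Fin m)).injective
  rw [rename_prodAssoc_rename_symm]
  apply MvPolynomial.funext
  intro x
  change aeval x _ = aeval x F
  rw [← tensorPt_curry k x, ← aeval_tensorPt_actTensor_fst, rename_prodAssoc_rename_symm]
  have h := hF ⟨A.transpose, by rw [Matrix.det_transpose, hA]⟩ 1 1 (fun a b c => x (a, b, c))
  rwa [Matrix.SpecialLinearGroup.coe_one, Matrix.SpecialLinearGroup.coe_mk] at h

/-- Second leg: `legSubst₂ A` fixes the reindexing of an `SL³`-invariant form, `det A = 1`.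
[cite: BurgisserIkenmeyer2017, §5 eq. (5.1)] -/
theorem legSubst₂_rename_symm_eq_of_isSL3Invariant {F : MvPolynomial (Fin m × Fin m × Fin m) k}
    (hF : IsSL3Invariant F) {A : Matrix (Fin m) (Fin m) k} (hA : A.det = 1) :
    legSubst₂ m A (rename (Equiv.prodAssoc (Fin m) (Fin m) (Fin m)).symm F) =
      rename (Equiv.prodAssoc (Fin m) (Fin m) (Fin m)).symm F := by
  apply rename_injective _ (Equiv.prodAssoc (Fin m) (Fin m) (Fin m)).injective
  rw [rename_prodAssoc_rename_symm]
  apply MvPolynomial.funext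
  intro x
  change aeval x _ = aeval x F
  rw [← tensorPt_curry k x, ← aeval_tensorPt_actTensor_snd, rename_prodAssoc_rename_symm]
  have h := hF 1 ⟨A.transpose, by rw [Matrix.det_transpose, hA]⟩ 1 (fun a b c => x (a, b, c))
  rwa [Matrix.SpecialLinearGroup.coe_one, Matrix.SpecialLinearGroup.coe_mk] at h

/-- Third leg: `legSubst₃ A` fixes the reindexing of an `SL³`-invariant form, `det A = 1`.
[cite: BurgisserIkenmeyer2017, §5 eq. (5.1)] -/
theorem legSubst₃_rename_symm_eq_of_isSL3Invariant {F : MvPolynomial (Fin m × Fin m × Fin m) k}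
    (hF : IsSL3Invariant F) {A : Matrix (Fin m) (Fin m) k} (hA : A.det = 1) :
    legSubst₃ m A (rename (Equiv.prodAssoc (Fin m) (Fin m) (Fin m)).symm F) =
      rename (Equiv.prodAssoc (Fin m) (Fin m) (Fin m)).symm F := by
  apply rename_injective _ (Equiv.prodAssoc (Fin m) (Fin m) (Fin m)).injective
  rw [rename_prodAssoc_rename_symm]
  apply MvPolynomial.funext
  intro x
  change aeval x _ = aeval x F
  rw [← tensorPt_curry k x, ← aeval_tensorPt_actTensor_thd, rename_prodAssoc_rename_symm]
  have h := hF 1 1 ⟨A.transpose, by rw [Matrix.det_transpose, hA]⟩ (fun a b c => x (a, b, c))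
  rwa [Matrix.SpecialLinearGroup.coe_one, Matrix.SpecialLinearGroup.coe_mk] at h

/-- **`O(⊗³k^m)^{SL³_m}_{mδ} → HW_□^{⊗3}`, first leg**: for `F ∈ O(⊗³k^m)^{SL³_m}_{mδ}` and
`M = tripleArr F` the symmetric triple array of (the reindexed) `F`, every `g ∈ GL_m` of
determinant `1` fixes `M` through the first leg: `P_{g ·₁ M} = g ·₁ P_M = g ·₁ F = F = P_M` and `P`
is injective on symmetric tensors (`eq_of_triplePoly_eq`); step of the dictionary
`O(⊗³)^{SL³}_{mδ} ≃ (HW_□^{⊗3})^{S_{mδ}}`. [cite: IkenmeyerPanova2017, §1.1] -/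
theorem legAct₁_tripleArr_eq_of_mem_sl3InvariantsOfDegree {D : ℕ}
    {F : MvPolynomial (Fin m × Fin m × Fin m) k} (hF : F ∈ sl3InvariantsOfDegree (Fin m) k D)
    (g : GL (Fin m) k) (hg : (g : Matrix (Fin m) (Fin m) k).det = 1) :
    legAct₁ g (tripleArr D (rename (Equiv.prodAssoc (Fin m) (Fin m) (Fin m)).symm F)) =
      tripleArr D (rename (Equiv.prodAssoc (Fin m) (Fin m) (Fin m)).symm F) := by
  rw [mem_sl3InvariantsOfDegree_iff] at hF
  have hsym := tripleArr_permute3 (k := k) (n := D)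
    (rename (Equiv.prodAssoc (Fin m) (Fin m) (Fin m)).symm F)
  refine eq_of_triplePoly_eq (legAct₁_permute3 g hsym) hsym ?_
  rw [triplePoly_legAct₁, triplePoly_tripleArr (hF.1.rename_isHomogeneous),
    legSubst₁_rename_symm_eq_of_isSL3Invariant k hF.2 hg]

/-- Second leg: unimodular `g` fixes `tripleArr F` through `legAct₂`, `F ∈ O(⊗³k^m)^{SL³_m}_{mδ}`.
[cite: IkenmeyerPanova2017, §1.1] -/
theorem legAct₂_tripleArr_eq_of_mem_sl3InvariantsOfDegree {D : ℕ}
    {F : MvPolynomial (Fin m × Fin m × Fin m) k} (hF : F ∈ sl3InvariantsOfDegree (Fin m) k D)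
    (g : GL (Fin m) k) (hg : (g : Matrix (Fin m) (Fin m) k).det = 1) :
    legAct₂ g (tripleArr D (rename (Equiv.prodAssoc (Fin m) (Fin m) (Fin m)).symm F)) =
      tripleArr D (rename (Equiv.prodAssoc (Fin m) (Fin m) (Fin m)).symm F) := by
  rw [mem_sl3InvariantsOfDegree_iff] at hF
  have hsym := tripleArr_permute3 (k := k) (n := D)
    (rename (Equiv.prodAssoc (Fin m) (Fin m) (Fin m)).symm F)
  refine eq_of_triplePoly_eq (legAct₂_permute3 g hsym) hsym ?_
  rw [triplePoly_legAct₂, triplePoly_tripleArr (hF.1.rename_isHomogeneous),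
    legSubst₂_rename_symm_eq_of_isSL3Invariant k hF.2 hg]

/-- Third leg: unimodular `g` fixes `tripleArr F` through `legAct₃`, `F ∈ O(⊗³k^m)^{SL³_m}_{mδ}`.
[cite: IkenmeyerPanova2017, §1.1] -/
theorem legAct₃_tripleArr_eq_of_mem_sl3InvariantsOfDegree {D : ℕ}
    {F : MvPolynomial (Fin m × Fin m × Fin m) k} (hF : F ∈ sl3InvariantsOfDegree (Fin m) k D)
    (g : GL (Fin m) k) (hg : (g : Matrix (Fin m) (Fin m) k).det = 1) :
    legAct₃ g (tripleArr D (rename (Equiv.prodAssoc (Fin m) (Fin m) (Fin m)).symm F)) =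
      tripleArr D (rename (Equiv.prodAssoc (Fin m) (Fin m) (Fin m)).symm F) := by
  rw [mem_sl3InvariantsOfDegree_iff] at hF
  have hsym := tripleArr_permute3 (k := k) (n := D)
    (rename (Equiv.prodAssoc (Fin m) (Fin m) (Fin m)).symm F)
  refine eq_of_triplePoly_eq (legAct₃_permute3 g hsym) hsym ?_
  rw [triplePoly_legAct₃, triplePoly_tripleArr (hF.1.rename_isHomogeneous),
    legSubst₃_rename_symm_eq_of_isSL3Invariant k hF.2 hg]

/-- **`O(⊗³k^m)^{SL³_m}_{mδ} → (HW_□ ⊗ HW_□ ⊗ HW_□)^{S_{mδ}}`**: the symmetric triple array of an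
`SL³`-invariant form of degree `mδ` lies in `symTripleHw □ □ □` — symmetric by construction
(`tripleArr_permute3`), and every partial function is fixed by the unimodular upper triangular
matrices, i.e. is a highest-weight vector of weight `□ = (δ,…,δ)`
(`unimodularBorelInvariants_eq_highestWeightSpace`). [cite: IkenmeyerPanova2017, §1.1] -/
theorem tripleArr_mem_symTripleHw_of_mem_sl3InvariantsOfDegree
    {F : MvPolynomial (Fin m × Fin m × Fin m) k} (hF : F ∈ sl3InvariantsOfDegree (Fin m) k (m * δ)) :
    tripleArr (m * δ) (rename (Equiv.prodAssoc (Fin m) (Fin m) (Fin m)).symm F) ∈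
      symTripleHw k m (m * δ) (Weight.ofPartition m (Nat.Partition.rectangle m δ))
        (Weight.ofPartition m (Nat.Partition.rectangle m δ))
        (Weight.ofPartition m (Nat.Partition.rectangle m δ)) := by
  set M := tripleArr (m * δ) (rename (Equiv.prodAssoc (Fin m) (Fin m) (Fin m)).symm F) with hM
  refine (mem_symTripleHw_iff _ _ _ M).2 ⟨?_, tripleArr_permute3 _⟩
  rw [mem_tripleHw_iff, ← unimodularBorelInvariants_eq_highestWeightSpace]
  refine ⟨fun w₂ w₃ a _ ha => ?_, fun w₁ w₃ a _ ha => ?_, fun w₁ w₂ a _ ha => ?_⟩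
  · funext u
    exact congrFun (legAct₁_tripleArr_eq_of_mem_sl3InvariantsOfDegree k hF a ha) ((u, w₂), w₃)
  · funext v
    exact congrFun (legAct₂_tripleArr_eq_of_mem_sl3InvariantsOfDegree k hF a ha) ((w₁, v), w₃)
  · funext w
    exact congrFun (legAct₃_tripleArr_eq_of_mem_sl3InvariantsOfDegree k hF a ha) ((w₁, w₂), w)

/-- **Degrees of nonzero `SL³_m`-invariants are multiples of `m`** (`E(m) ⊆ mℕ`; BI 2017 Lemma 5.1,
"`ι(t) = (t·id, id, id)` … `t ∈ μ_m`"), here read off the word model: a nonzero invariant form `F` of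
degree `D` has a nonzero symmetric array, whose partial functions are unimodular-Borel invariants,
and the words in the support of such an invariant have constant content `(c, …, c)`, `mc = D`
(`wordContent_eq_of_mem_unimodularBorelInvariants`: the torus element `diag(2, 2⁻¹)` of `SL_m`).
(The tree's `card_dvd_of_mem_genericTensorDegreeMonoid` proves the same over `ℂ` with a root of
unity; this version holds over any field of characteristic zero.) [cite: BurgisserIkenmeyer2017, Lemma 5.1] -/
theorem dvd_of_mem_sl3InvariantsOfDegree_of_ne_zero {D : ℕ}
    {F : MvPolynomial (Fin m × Fin m × Fin m) k} (hF : F ∈ sl3InvariantsOfDegree (Fin m) k D)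
    (hF0 : F ≠ 0) : m ∣ D := by
  classical
  set M := tripleArr D (rename (Equiv.prodAssoc (Fin m) (Fin m) (Fin m)).symm F) with hM
  have hM0 : M ≠ 0 := by
    intro h0
    apply hF0
    have hP : triplePoly M = rename (Equiv.prodAssoc (Fin m) (Fin m) (Fin m)).symm F :=
      triplePoly_tripleArr (((mem_sl3InvariantsOfDegree_iff _ _).1 hF).1.rename_isHomogeneous)
    rw [h0, triplePoly_zero] at hP
    have := congrArg (rename (Equiv.prodAssoc (Fin m) (Fin m) (Fin m))) hP
    rw [rename_prodAssoc_rename_symm, map_zero] at this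
    exact this.symm
  obtain ⟨t, ht⟩ : ∃ t, M t ≠ 0 := by
    by_contra hall
    push Not at hall
    exact hM0 (funext hall)
  have hy : (fun u => M ((u, t.1.2), t.2)) ∈ unimodularBorelInvariants k m D := by
    intro a _ ha
    funext u
    exact congrFun (legAct₁_tripleArr_eq_of_mem_sl3InvariantsOfDegree k hF a ha) ((u, t.1.2), t.2)
  have hw : (fun u => M ((u, t.1.2), t.2)) t.1.1 ≠ 0 := ht
  have hconst := wordContent_eq_of_mem_unimodularBorelInvariants k hy hw
  have hsum := sum_wordContent t.1.1
  by_cases hm : m = 0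
  · subst hm
    simp only [Finset.univ_eq_empty, Finset.sum_empty] at hsum
    rw [← hsum]
  · obtain ⟨i₀⟩ : Nonempty (Fin m) := ⟨⟨0, Nat.pos_of_ne_zero hm⟩⟩
    rw [Finset.sum_congr rfl fun j _ => hconst j i₀, Finset.sum_const, Finset.card_univ,
      Fintype.card_fin, smul_eq_mul] at hsum
    exact ⟨_, hsum.symm⟩

end FormSide

/-! ### §4 The dictionary is a linear equivalence; the dimension formula -/

section Dimension

variable (k : Type*) [Field k] [CharZero k] (m δ : ℕ)

/-- **The dictionary `O(⊗³k^m)^{SL³_m}_{mδ} ≃ (HW_□ ⊗ HW_□ ⊗ HW_□)^{S_{mδ}}`** (characteristic zero):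
a `k`-linear equivalence `F ↦` the symmetric triple array of `F` (reindexed to the dictionary's
alphabet `(Fin m × Fin m) × Fin m`), with inverse `M ↦ P_M` (reindexed back); the two composites
are identities by `triplePoly_tripleArr` (forms of degree `mδ`) and `tripleArr_triplePoly`
(symmetric tensors). Stated as an existence with its defining formula (this proofs file declares no
definition). [cite: IkenmeyerPanova2017, §1.1] -/
theorem exists_linearEquiv_sl3InvariantsOfDegree_symTripleHw :
    ∃ e : sl3InvariantsOfDegree (Fin m) k (m * δ) ≃ₗ[k]
        symTripleHw k m (m * δ) (Weight.ofPartition m (Nat.Partition.rectangle m δ))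
          (Weight.ofPartition m (Nat.Partition.rectangle m δ))
          (Weight.ofPartition m (Nat.Partition.rectangle m δ)),
      ∀ F, ((e F : symTripleHw k m (m * δ) (Weight.ofPartition m (Nat.Partition.rectangle m δ))
          (Weight.ofPartition m (Nat.Partition.rectangle m δ))
          (Weight.ofPartition m (Nat.Partition.rectangle m δ))) : Word3 m (m * δ) → k) =
        tripleArr (m * δ) (rename (Equiv.prodAssoc (Fin m) (Fin m) (Fin m)).symm
          (F : MvPolynomial (Fin m × Fin m × Fin m) k)) := by
  refine ⟨{ toFun := fun F => ⟨tripleArr (m * δ) (rename (Equiv.prodAssoc (Fin m) (Fin m) (Fin m)).symm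
                (F : MvPolynomial (Fin m × Fin m × Fin m) k)),
              tripleArr_mem_symTripleHw_of_mem_sl3InvariantsOfDegree k F.2⟩
            map_add' := fun F G => ?_
            map_smul' := fun c F => ?_
            invFun := fun M => ⟨rename (Equiv.prodAssoc (Fin m) (Fin m) (Fin m))
                (triplePoly (M : Word3 m (m * δ) → k)),
              rename_triplePoly_mem_sl3InvariantsOfDegree k M.2.1⟩
            left_inv := fun F => ?_
            right_inv := fun M => ?_ }, fun F => rfl⟩
  · apply Subtype.ext
    simp only [Submodule.coe_add, map_add, tripleArr_add]
  · apply Subtype.ext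
    simp only [Submodule.coe_smul, map_smul, tripleArr_smul, RingHom.id_apply]
  · apply Subtype.ext
    have hF := ((mem_sl3InvariantsOfDegree_iff _ _).1 F.2).1
    simp only
    rw [triplePoly_tripleArr (hF.rename_isHomogeneous), rename_prodAssoc_rename_symm]
  · apply Subtype.ext
    simp only
    rw [rename_symm_rename_prodAssoc, tripleArr_triplePoly M.2.2]

/-- `O(⊗³k^m)^{SL³_m}_{mδ}` is finite-dimensional (it is linearly equivalent to a space of
functions on the finite set of triples of words; BI 2017 §5 speaks of its dimension).
[cite: BurgisserIkenmeyer2017, §5 (before eq. (5.2))] -/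
theorem finite_sl3InvariantsOfDegree : Module.Finite k (sl3InvariantsOfDegree (Fin m) k (m * δ)) := by
  obtain ⟨e, -⟩ := exists_linearEquiv_sl3InvariantsOfDegree_symTripleHw k m δ
  exact Module.Finite.equiv e.symm

/-- **`dim O(⊗³k^m)^{SL³_m}_{mδ} = k_m(δ) = k(m × δ, m × δ, m × δ)`** over any field of
characteristic zero and for every `m` (BI 2017 §5, L2019–2026: "It is a well-known fact … that
`dim O(⊗³ℂ^m)^{SL³_m}_{mδ} = k(m × δ, m × δ, m × δ)`"), by the linear equivalence with
`symTripleHw □ □ □` and `finrank_symTripleHw` (`□ = m × δ` has at most `m` parts).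
[cite: BurgisserIkenmeyer2017, §5 (before eq. (5.2))] -/
theorem finrank_sl3InvariantsOfDegree_eq_kronRect :
    Module.finrank k (sl3InvariantsOfDegree (Fin m) k (m * δ)) = kronRect k m δ := by
  obtain ⟨e, -⟩ := exists_linearEquiv_sl3InvariantsOfDegree_symTripleHw k m δ
  rw [e.finrank_eq, kronRect]
  exact finrank_symTripleHw _ _ _ (Nat.Partition.card_parts_rectangle_le m δ)
    (Nat.Partition.card_parts_rectangle_le m δ) (Nat.Partition.card_parts_rectangle_le m δ)

/-- Nonvanishing form of the dimension formula: `O(⊗³k^m)^{SL³_m}_{mδ} ≠ 0 ↔ k_m(δ) > 0`.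
[cite: BurgisserIkenmeyer2017, §5 eq. (5.2)] -/
theorem sl3InvariantsOfDegree_ne_bot_iff_kronRect_pos :
    sl3InvariantsOfDegree (Fin m) k (m * δ) ≠ ⊥ ↔ 0 < kronRect k m δ := by
  haveI := finite_sl3InvariantsOfDegree k m δ
  rw [← finrank_sl3InvariantsOfDegree_eq_kronRect, Module.finrank_pos_iff, Submodule.nontrivial_iff_ne_bot]

end Dimension

/-! ### §5 The named facts of BI 2017 §5: the dimension formula and eq. (5.2) -/

section Facts

/-- **BI 2017, §5 (L2019–2026, p0018) — DISCHARGED**: `theorem BI2017_dim_sl3Invariants_holds :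
BI2017_dim_sl3Invariants`, "`dim O(⊗³ℂ^m)^{SL³_m}_{mδ} = k_m(δ)`" for `m ≥ 1` (in fact for every
`m`, `finrank_sl3InvariantsOfDegree_eq_kronRect`). [cite: BurgisserIkenmeyer2017, §5 (before eq. (5.2))] -/
theorem BI2017_dim_sl3Invariants_holds : BI2017_dim_sl3Invariants :=
  fun m δ _ => finrank_sl3InvariantsOfDegree_eq_kronRect ℂ m δ

/-- **The generic degree monoid through Kronecker coefficients**: `E(m) = {mδ : k_m(δ) > 0}` for
every `m` — `E(m) ⊆ mℕ` (`dvd_of_mem_sl3InvariantsOfDegree_of_ne_zero`) and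
`mδ ∈ E(m) ↔ O(⊗³ℂ^m)^{SL³_m}_{mδ} ≠ 0 ↔ k_m(δ) > 0`
(BI 2017 eq. (5.2), there written `E'(m) = {δ | k_m(δ) > 0}` with `E(m) = m a(m) E'(m)`).
[cite: BurgisserIkenmeyer2017, §5 eq. (5.2)] -/
theorem genericTensorDegreeMonoid_eq_kronRect (m : ℕ) :
    genericTensorDegreeMonoid (Fin m) ℂ = {d | ∃ δ : ℕ, d = m * δ ∧ 0 < kronRect ℂ m δ} := by
  ext d
  constructor
  · intro hd
    obtain ⟨F, hFh, hFi, hF0⟩ := hd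
    obtain ⟨δ, rfl⟩ : m ∣ d :=
      dvd_of_mem_sl3InvariantsOfDegree_of_ne_zero ℂ ((mem_sl3InvariantsOfDegree_iff _ _).2 ⟨hFh, hFi⟩) hF0
    refine ⟨δ, rfl, ?_⟩
    rw [← sl3InvariantsOfDegree_ne_bot_iff_kronRect_pos, Submodule.ne_bot_iff]
    exact ⟨F, (mem_sl3InvariantsOfDegree_iff _ _).2 ⟨hFh, hFi⟩, hF0⟩
  · rintro ⟨δ, rfl, hδ⟩
    rw [← sl3InvariantsOfDegree_ne_bot_iff_kronRect_pos, Submodule.ne_bot_iff] at hδ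
    obtain ⟨F, hF, hF0⟩ := hδ
    rw [mem_sl3InvariantsOfDegree_iff] at hF
    exact ⟨F, hF.1, hF.2, hF0⟩

/-- **BI 2017, eq. (5.2) (L2029, p0018) — DISCHARGED**: `theorem BI2017_eq_5_2_holds : BI2017_eq_5_2`,
"`E'(m) = {δ ∈ ℕ | k_m(δ) > 0}` if `m > 2`", typed as `E(m) = {mδ | k_m(δ) > 0}` (it holds for every
`m`, `genericTensorDegreeMonoid_eq_kronRect`). [cite: BurgisserIkenmeyer2017, §5 eq. (5.2)] -/
theorem BI2017_eq_5_2_holds : BI2017_eq_5_2 :=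
  fun m _ => genericTensorDegreeMonoid_eq_kronRect m

end Facts

/-! ### §6 Vanishing of `k_m(δ)` for `δ² < m` and the value `k_{n²}(n) = 1` (Thm. 5.9 (1), (3)) -/

section KroneckerRectangles

variable (k : Type*) [Field k] [CharZero k]

/-- Column lengths of the Young diagram of the `a × b` rectangle: `a` boxes in each of the first `b`
columns, none beyond (plumbing). [folklore] -/
private theorem colLen_youngDiagram_rectangle (a b j : ℕ) :
    (Nat.Partition.rectangle a b).youngDiagram.colLen j = if j < b then a else 0 := by
  have key : ∀ i, i < (Nat.Partition.rectangle a b).youngDiagram.colLen j ↔ i < a ∧ j < b := by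
    intro i
    rw [← YoungDiagram.mem_iff_lt_colLen]
    exact Literature.Computability.Complexity.mem_youngDiagram_rectangle a b (i, j)
  split_ifs with hj
  · apply le_antisymm
    · by_contra h
      exact (lt_irrefl a) ((key a).1 (not_le.1 h)).1
    · by_contra h
      have h' := not_le.1 h
      have := (key ((Nat.Partition.rectangle a b).youngDiagram.colLen j)).2 ⟨h', hj⟩
      exact lt_irrefl _ this
  · apply Nat.eq_zero_of_not_pos
    intro h
    exact hj ((key 0).1 h).2

/-- A point set with marginals those of three `m × δ` rectangles lies in the box `[0, δ)³`
(plumbing). [folklore] -/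
private theorem subset_box_of_hasMarginals_rectangle {m δ : ℕ} {P : Finset (ℕ × ℕ × ℕ)}
    (hP : HasMarginals P (Nat.Partition.rectangle m δ) (Nat.Partition.rectangle m δ)
      (Nat.Partition.rectangle m δ)) :
    P ⊆ Finset.range δ ×ˢ (Finset.range δ ×ˢ Finset.range δ) := by
  intro p hp
  obtain ⟨hx, hy, hz⟩ := hP
  have h1 : 0 < xMarginal P p.1 := Finset.card_pos.2 ⟨p, Finset.mem_filter.2 ⟨hp, rfl⟩⟩
  have h2 : 0 < yMarginal P p.2.1 := Finset.card_pos.2 ⟨p, Finset.mem_filter.2 ⟨hp, rfl⟩⟩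
  have h3 : 0 < zMarginal P p.2.2 := Finset.card_pos.2 ⟨p, Finset.mem_filter.2 ⟨hp, rfl⟩⟩
  rw [hx, colLen_youngDiagram_rectangle] at h1
  rw [hy, colLen_youngDiagram_rectangle] at h2
  rw [hz, colLen_youngDiagram_rectangle] at h3
  simp only [Finset.mem_product, Finset.mem_range]
  refine ⟨?_, ?_, ?_⟩
  · by_contra h; rw [if_neg h] at h1; exact lt_irrefl 0 h1
  · by_contra h; rw [if_neg h] at h2; exact lt_irrefl 0 h2
  · by_contra h; rw [if_neg h] at h3; exact lt_irrefl 0 h3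

/-- **`k_m(δ) > 0` with `δ > 0` forces `m ≤ δ²`** (BI 2017, proof of Thm. 5.9(1): "`k(λ,μ,ν) = 0` if
`ℓ(λ) > ℓ(μ)ℓ(ν)`. Hence `k_m(δ) = 0` if `m > δ²`"). Proved here through the point sets of
Ikenmeyer–Mulmuley–Walter (`exists_hasMarginals_of_kroneckerCoeff_pos`): a positive `k_m(δ)` yields an
`mδ`-point SET in `ℕ³` all of whose marginals are those of the `m × δ` rectangle, i.e. a subset of
the box `[0, δ)³`; so `mδ ≤ δ³`. [cite: BurgisserIkenmeyer2017, Thm. 5.9 (proof of (1))] -/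
theorem le_sq_of_kronRect_pos {m δ : ℕ} (hδ : 0 < δ) (h : 0 < kronRect k m δ) : m ≤ δ ^ 2 := by
  obtain ⟨P, hP⟩ := exists_hasMarginals_of_kroneckerCoeff_pos k h
  have hcard : P.card = m * δ := hP.card_eq
  have hsub := subset_box_of_hasMarginals_rectangle hP
  have hle : m * δ ≤ δ * (δ * δ) := by
    rw [← hcard]
    refine (Finset.card_le_card hsub).trans ?_
    simp [Finset.card_product, Finset.card_range]
  rw [sq]
  exact Nat.le_of_mul_le_mul_right (by simpa [mul_comm, mul_assoc] using hle) hδ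

/-- **BI 2017, Thm. 5.9, proof of (1): `k_m(δ) = 0` if `m > δ²`** (`δ > 0`; for `δ = 0`,
`k_m(0) = k(∅,∅,∅) = 1`). [cite: BurgisserIkenmeyer2017, Thm. 5.9 (proof of (1))] -/
theorem kronRect_eq_zero_of_sq_lt {m δ : ℕ} (hδ : 0 < δ) (h : δ ^ 2 < m) : kronRect k m δ = 0 := by
  by_contra hne
  exact absurd (le_sq_of_kronRect_pos k hδ (Nat.pos_of_ne_zero hne)) (not_le.2 h)

/-- The combinatorial cube `[0, n)³` is a pyramid (a down-set of `ℕ³`) (plumbing). [folklore] -/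
private theorem isPyramid_cube (n : ℕ) :
    IsPyramid (Finset.range n ×ˢ (Finset.range n ×ˢ Finset.range n)) := by
  rw [isPyramid_iff]
  intro p hp q h1 h2 h3
  simp only [Finset.mem_product, Finset.mem_range] at hp ⊢
  exact ⟨lt_of_le_of_lt h1 hp.1, lt_of_le_of_lt h2 hp.2.1, lt_of_le_of_lt h3 hp.2.2⟩

/-- The cube `[0, n)³` has the marginals of three `n² × n` rectangles: `n²` points in each of
the `n` slices of each direction (plumbing). [folklore] -/
private theorem hasMarginals_cube (n : ℕ) :
    HasMarginals (Finset.range n ×ˢ (Finset.range n ×ˢ Finset.range n))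
      (Nat.Partition.rectangle (n * n) n) (Nat.Partition.rectangle (n * n) n)
      (Nat.Partition.rectangle (n * n) n) := by
  refine ⟨fun i => ?_, fun j => ?_, fun l => ?_⟩
  · rw [colLen_youngDiagram_rectangle, xMarginal]
    split_ifs with hi
    · have h : (Finset.range n ×ˢ (Finset.range n ×ˢ Finset.range n)).filter (fun p : ℕ × ℕ × ℕ => p.1 = i) =
          {i} ×ˢ (Finset.range n ×ˢ Finset.range n) := by
        ext p
        simp only [Finset.mem_filter, Finset.mem_product, Finset.mem_range, Finset.mem_singleton]
        constructor
        · rintro ⟨⟨-, h2, h3⟩, rfl⟩; exact ⟨rfl, h2, h3⟩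
        · rintro ⟨rfl, h2, h3⟩; exact ⟨⟨hi, h2, h3⟩, rfl⟩
      rw [h]; simp [Finset.card_product]
    · rw [Finset.card_eq_zero, Finset.filter_eq_empty_iff]
      intro p hp
      simp only [Finset.mem_product, Finset.mem_range] at hp
      rintro rfl; exact hi hp.1
  · rw [colLen_youngDiagram_rectangle, yMarginal]
    split_ifs with hj
    · have h : (Finset.range n ×ˢ (Finset.range n ×ˢ Finset.range n)).filter (fun p : ℕ × ℕ × ℕ => p.2.1 = j) =
          Finset.range n ×ˢ ({j} ×ˢ Finset.range n) := by
        ext p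
        simp only [Finset.mem_filter, Finset.mem_product, Finset.mem_range, Finset.mem_singleton]
        constructor
        · rintro ⟨⟨h1, -, h3⟩, rfl⟩; exact ⟨h1, rfl, h3⟩
        · rintro ⟨h1, rfl, h3⟩; exact ⟨⟨h1, hj, h3⟩, rfl⟩
      rw [h]; simp [Finset.card_product]
    · rw [Finset.card_eq_zero, Finset.filter_eq_empty_iff]
      intro p hp
      simp only [Finset.mem_product, Finset.mem_range] at hp
      rintro rfl; exact hj hp.2.1
  · rw [colLen_youngDiagram_rectangle, zMarginal]
    split_ifs with hl
    · have h : (Finset.range n ×ˢ (Finset.range n ×ˢ Finset.range n)).filter (fun p : ℕ × ℕ × ℕ => p.2.2 = l) =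
          Finset.range n ×ˢ (Finset.range n ×ˢ {l}) := by
        ext p
        simp only [Finset.mem_filter, Finset.mem_product, Finset.mem_range, Finset.mem_singleton]
        constructor
        · rintro ⟨⟨h1, h2, -⟩, rfl⟩; exact ⟨h1, h2, rfl⟩
        · rintro ⟨h1, h2, rfl⟩; exact ⟨⟨h1, h2, hl⟩, rfl⟩
      rw [h]; simp [Finset.card_product]
    · rw [Finset.card_eq_zero, Finset.filter_eq_empty_iff]
      intro p hp
      simp only [Finset.mem_product, Finset.mem_range] at hp
      rintro rfl; exact hl hp.2.2

/-- **`k_{n²}(n) ≥ 1`**: the cube `[0,n)³` is a pyramid with the marginals of three `n² × n`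
rectangles, so the pyramid lower bound of Ikenmeyer–Mulmuley–Walter (Manivel, Bürgisser–Ikenmeyer)
gives `k(n² × n, n² × n, n² × n) > 0` (BI 2017, Rem. 5.10: "`k_{n²}(n) = 1` also immediately follows
combinatorially from the upper and lower bounds … in [Man:97] and [BI:13], see also [IMW:15]").
[cite: BurgisserIkenmeyer2017, Rem. 5.10] -/
theorem kronRect_sq_pos (n : ℕ) : 0 < kronRect k (n * n) n :=
  kroneckerCoeff_pos_of_isPyramid k (isPyramid_cube n) (hasMarginals_cube n)

/-- **An anti-invariant triple tensor on `n = N³` positions is determined by one value**: if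
`M(τ · t) = sgn(τ) M(t)` for all `τ ∈ S_n`, the alphabet has `N³ = n` letter triples, and `M`
vanishes at one configuration `t₀` whose positions carry pairwise distinct letter triples, then
`M = 0` — any `t` with `M(t) ≠ 0` is injective on positions
(`zip3_injective_of_antiInvariant_of_ne_zero`), hence a bijection onto the `N³` letter triples, hence
a position permutation of `t₀`. (IMW: the `ψ_P` with `P` a point SET span the antisymmetric cube.)
[cite: IkenmeyerMulmuleyWalter2017, §2 (the vectors ψ_P)] -/
theorem eq_zero_of_antiInvariant_of_apply_eq_zero {N n : ℕ} {M : Word3 N n → k}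
    (hanti : ∀ τ t, M (permute3 τ t) = ((Equiv.Perm.sign τ : ℤ) : k) * M t)
    (hcard : Fintype.card ((Fin N × Fin N) × Fin N) = n) {t₀ : Word3 N n}
    (h₀ : Function.Bijective (zip3 t₀)) (hM : M t₀ = 0) : M = 0 := by
  funext t
  by_contra ht
  have hinj := zip3_injective_of_antiInvariant_of_ne_zero k hanti ht
  have hbij : Function.Bijective (zip3 t) := by
    rw [Fintype.bijective_iff_injective_and_card]
    exact ⟨hinj, by rw [hcard, Fintype.card_fin]⟩
  set τ : Equiv.Perm (Fin n) := (Equiv.ofBijective _ hbij).trans (Equiv.ofBijective _ h₀).symm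
    with hτ
  have hperm : permute3 τ t₀ = t := by
    apply (zip3 (N := N) (n := n)).injective
    rw [zip3_permute3]
    funext p
    simp only [Function.comp_apply, hτ, Equiv.trans_apply]
    exact Equiv.ofBijective_apply_symm_apply (zip3 t₀) h₀ _
  have := hanti τ t₀
  rw [hperm, hM, mul_zero] at this
  exact ht this

/-- A reference configuration on `N³` positions with pairwise distinct letter triples (plumbing).
[folklore] -/
private theorem exists_zip3_bijective (N : ℕ) :
    ∃ t₀ : Word3 N (N * N * N), Function.Bijective (zip3 t₀) := by
  let e : Fin (N * N * N) ≃ (Fin N × Fin N) × Fin N :=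
    finProdFinEquiv.symm.trans (Equiv.prodCongr finProdFinEquiv.symm (Equiv.refl (Fin N)))
  refine ⟨(zip3 (N := N) (n := N * N * N)).symm e, ?_⟩
  rw [Equiv.apply_symm_apply]
  exact e.bijective

/-- **`k_{n²}(n) ≤ 1`**: `k(n² × n, n² × n, n² × n) = k((n²)ⁿ, (n²)ⁿ, n² × n)` (transposing two
arguments) is the dimension of the anti-invariant triple tensors in `HW_{(n²)ⁿ}^{⊗3}` on `n³`
positions over the alphabet `[0,n)` (`finrank_invariants_signTwist_tripleHwRep`), and these are
determined by one value (`eq_zero_of_antiInvariant_of_apply_eq_zero`): the upper bound `k ≤ t = 1`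
of Ikenmeyer–Mulmuley–Walter / Bürgisser–Ikenmeyer for the cube (BI 2017, Rem. 5.10).
[cite: BurgisserIkenmeyer2017, Rem. 5.10] -/
theorem kronRect_sq_le_one (n : ℕ) : kronRect k (n * n) n ≤ 1 := by
  set lam : Nat.Partition (n * n * n) := Nat.Partition.rectangle (n * n) n with hlam
  have hT : lam.transpose.parts.card ≤ n := by
    rw [hlam, Literature.Computability.Complexity.transpose_rectangle_parts]
    exact Nat.Partition.card_parts_rectangle_le n (n * n)
  have hdim := finrank_invariants_signTwist_tripleHwRep (k := k) (N := n) lam.transpose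
    lam.transpose lam.transpose hT hT hT
  rw [Nat.Partition.transpose_transpose, ← kroneckerCoeff_transpose₁₂] at hdim
  change kroneckerCoeff k lam lam lam ≤ 1
  rw [← hdim]
  obtain ⟨t₀, h₀⟩ := exists_zip3_bijective n
  -- evaluation at `t₀`, an injective linear functional on the anti-invariants
  refine le_trans (LinearMap.finrank_le_finrank_of_injective
    (f := (LinearMap.proj t₀).comp ((Submodule.subtype _).comp (Submodule.subtype _))) ?_) ?_
  · intro x y hxy
    simp only [LinearMap.coe_comp, Function.comp_apply, Submodule.coe_subtype, LinearMap.proj_apply]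
      at hxy
    rw [← sub_eq_zero]
    set z := x - y with hz
    set Mz : Word3 n (n * n * n) → k := ((z : tripleHw k n (n * n * n)
      (Weight.ofPartition n lam.transpose) (Weight.ofPartition n lam.transpose)
      (Weight.ofPartition n lam.transpose)) : Word3 n (n * n * n) → k) with hMz
    have hz' : Mz t₀ = 0 := by
      rw [hMz, hz, Submodule.coe_sub, Submodule.coe_sub, Pi.sub_apply, hxy, sub_self]
    have hanti : ∀ τ t, Mz (permute3 τ t) = ((Equiv.Perm.sign τ : ℤ) : k) * Mz t := by
      intro τ t
      have hinv := (Representation.mem_invariants _ _).1 z.2 τ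
      rw [signTwist_apply, LinearMap.smul_apply] at hinv
      have := congrArg (fun y : tripleHw k n (n * n * n) (Weight.ofPartition n lam.transpose)
        (Weight.ofPartition n lam.transpose) (Weight.ofPartition n lam.transpose) =>
          (y : Word3 n (n * n * n) → k) t) hinv
      simp only [Submodule.coe_smul_of_tower, Pi.smul_apply, coe_tripleHwRep_apply, smul_eq_mul]
        at this
      have hs := sign_cast_mul_self (k := k) τ
      have e : Mz (permute3 τ t) = ((Equiv.Perm.sign τ : ℤ) : k) *
          (((Equiv.Perm.sign τ : ℤ) : k) * Mz (permute3 τ t)) := by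
        rw [← mul_assoc, hs, one_mul]
      rw [e, this]
    have hcard : Fintype.card ((Fin n × Fin n) × Fin n) = n * n * n := by
      simp only [Fintype.card_prod, Fintype.card_fin]
    have h0 : Mz = 0 := eq_zero_of_antiInvariant_of_apply_eq_zero k hanti hcard h₀ hz'
    apply Subtype.ext
    apply Subtype.ext
    exact h0
  · rw [Module.finrank_self]

/-- **BI 2017, Thm. 5.9 (3), first sentence — PROVED: `k_{n²}(n) = 1`** for every `n` (print: the
complement symmetry of Kronecker coefficients inside `n² × n` [Ike12b, Cor. 4.4.15]; here the
Manivel / Bürgisser–Ikenmeyer / IMW bounds of Rem. 5.10: the cube is the only point set, and a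
pyramid, with these marginals). [cite: BurgisserIkenmeyer2017, Thm. 5.9 (3)] -/
theorem kronRect_sq_eq_one (n : ℕ) : kronRect k (n * n) n = 1 :=
  le_antisymm (kronRect_sq_le_one k n) (kronRect_sq_pos k n)

end KroneckerRectangles

/-! ### §7 BI 2017, Thm. 5.9: part (3) proved, part (1) modulo `e(m) > 0`, and the assembly -/

section Theorem59

/-- **BI 2017, Thm. 5.9 (3) — PROVED: `k_{n²}(n) = 1`** (`n ≥ 1` in print; every `n` here).
[cite: BurgisserIkenmeyer2017, Thm. 5.9 (3)] -/
theorem BI2017_thm_5_9_part3_kronRect (n : ℕ) : kronRect ℂ (n * n) n = 1 :=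
  kronRect_sq_eq_one ℂ n

/-- **BI 2017, Thm. 5.9 (3), second sentence — PROVED: `e'(n²) = n`, i.e. `e(n²) = n³`** (`n ≥ 1`;
print `n ≥ 2` through `a(n²) = 1`): `n³ = n²·n ∈ E(n²)` as `k_{n²}(n) = 1 > 0`, and a positive
`n² δ ∈ E(n²)` has `k_{n²}(δ) > 0`, so `n² ≤ δ²`, `n ≤ δ`. [cite: BurgisserIkenmeyer2017, Thm. 5.9 (3)] -/
theorem BI2017_thm_5_9_part3_minimalDegree (n : ℕ) (hn : 1 ≤ n) :
    genericTensorMinimalDegree (Fin (n * n)) ℂ = n * n * n := by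
  have hm : 0 < n * n := Nat.mul_pos hn hn
  have hE := genericTensorDegreeMonoid_eq_kronRect (n * n)
  unfold genericTensorMinimalDegree
  rw [hE]
  have hmem : n * n * n ∈ {d | d ∈ {d | ∃ δ : ℕ, d = n * n * δ ∧ 0 < kronRect ℂ (n * n) δ} ∧ 0 < d} :=
    ⟨⟨n, rfl, by rw [kronRect_sq_eq_one]; exact one_pos⟩, Nat.mul_pos hm hn⟩
  refine le_antisymm (Nat.sInf_le hmem) (le_csInf ⟨_, hmem⟩ ?_)
  rintro d ⟨⟨δ, rfl, hδ⟩, hd⟩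
  have hδ0 : 0 < δ := Nat.pos_of_ne_zero (by rintro rfl; simp at hd)
  have h := le_sq_of_kronRect_pos ℂ hδ0 hδ
  rw [sq] at h
  exact Nat.mul_le_mul_left (n * n) (Nat.mul_self_le_mul_self_iff.1 h)

/-- **BI 2017, Thm. 5.9 (1) modulo `e(m) > 0`**: if the generic minimal degree `e(m)` is positive
(i.e. `⊗³ℂ^m` carries a non-constant `SL³_m`-invariant — in print implicit in "`e'(m)` is the
minimum `δ` such that `k_m(δ) > 0`"), then `m ∣ e(m)` and `⌈√m⌉ ≤ e'(m) = e(m)/m`, i.e.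
`m ≤ (e(m)/m)²`: `e(m) = mδ` with `k_m(δ) > 0`, `δ > 0`, so `m ≤ δ²`. (`m ≥ 1`; print `m > 2`.)
[cite: BurgisserIkenmeyer2017, Thm. 5.9 (1)] -/
theorem BI2017_thm_5_9_part1_of_pos (m : ℕ) (hm : 0 < m)
    (he : 0 < genericTensorMinimalDegree (Fin m) ℂ) :
    m ∣ genericTensorMinimalDegree (Fin m) ℂ ∧
      m ≤ (genericTensorMinimalDegree (Fin m) ℂ / m) ^ 2 := by
  have hE := genericTensorDegreeMonoid_eq_kronRect m
  have hne : {d | d ∈ genericTensorDegreeMonoid (Fin m) ℂ ∧ 0 < d}.Nonempty := by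
    by_contra h
    rw [Set.not_nonempty_iff_eq_empty] at h
    unfold genericTensorMinimalDegree at he
    rw [h, Nat.sInf_empty] at he
    exact lt_irrefl 0 he
  have hmem := Nat.sInf_mem hne
  change genericTensorMinimalDegree (Fin m) ℂ ∈ _ at hmem
  obtain ⟨hin, hpos⟩ := hmem
  rw [hE] at hin
  obtain ⟨δ, hδe, hδ⟩ := hin
  rw [hδe] at hpos ⊢
  have hδ0 : 0 < δ := Nat.pos_of_ne_zero (by rintro rfl; simp at hpos)
  refine ⟨dvd_mul_right m δ, ?_⟩
  rw [Nat.mul_div_cancel_left δ hm]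
  exact le_sq_of_kronRect_pos ℂ hδ0 hδ

/-- **BI 2017, Thm. 5.9, assembled from what is proved here**: the named fact `BI2017_thm_5_9`
follows from (i) the positivity of the generic minimal degree `e(m)` for `m > 2` (existence of a
non-constant `SL³_m`-invariant on `⊗³ℂ^m`; GIT, not proved in the tree) and (ii) its Alon–Tarsi
clause (2) (the invariant of degree `m²` whose value at `⟨m⟩` counts column-even minus column-odd
Latin squares; not proved here). Parts (1) (given (i)) and (3) are theorems of this file.
[cite: BurgisserIkenmeyer2017, Thm. 5.9] -/
theorem BI2017_thm_5_9_of_pos_of_alonTarsi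
    (hpos : ∀ m : ℕ, 2 < m → 0 < genericTensorMinimalDegree (Fin m) ℂ)
    (hAT : ∀ m : ℕ, 2 < m → Kumar2015.latinColCount m ≠ 0 →
      genericTensorMinimalDegree (Fin m) ℂ ≤ m * m) :
    BI2017_thm_5_9 := by
  refine ⟨fun m hm => BI2017_thm_5_9_part1_of_pos m (by omega) (hpos m hm), hAT,
    fun n _ => BI2017_thm_5_9_part3_kronRect n,
    fun n hn => BI2017_thm_5_9_part3_minimalDegree n (by omega)⟩

end Theorem59

/-! ### §8 Examples 5.5 / 5.6: `E(3) = {3δ : δ ≠ 1}`, `e(3) = 6`, `e(4) = 8`, `e(9) = 27`, `e(16) = 64` -/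

section Examples

open Literature.RepresentationTheory.FiniteGroups.MNEval (kronSum kroneckerCoeff_pos_iff_kronSum_pos)

/-- Rows of the rectangle (plumbing). [folklore] -/
private theorem getD_sortedParts_rectangle' (a b r : ℕ) :
    (Nat.Partition.rectangle a b).sortedParts.getD r 0 = if r < a then b else 0 := by
  rcases Nat.eq_zero_or_pos b with rfl | hb
  · have h0 : (Nat.Partition.rectangle a 0).sortedParts = [] := by
      rw [← List.length_eq_zero_iff, Nat.Partition.length_sortedParts]
      simp [Nat.Partition.rectangle, Nat.Partition.ofSums]
    rw [h0]
    simp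
  · rw [Nat.Partition.sortedParts_rectangle a b hb.ne', List.getD_eq_getElem?_getD, List.getElem?_replicate]
    split_ifs <;> rfl

/-- **`k_3(2) > 0` and `k_3(3) > 0`** (they are `1`: Ex. 5.5 "`k_3(2) = 1`", "`k_3(3) = 1` states the
existence and uniqueness of Strassen's invariant"), certified in the kernel by the tree's
Murnaghan–Nakayama evaluator. [cite: BurgisserIkenmeyer2017, Ex. 5.5] -/
theorem kronRect_three_two_pos : 0 < kronRect ℂ 3 2 := by
  rw [kronRect, kroneckerCoeff_pos_iff_kronSum_pos, Nat.Partition.sortedParts_rectangle 3 2 (by norm_num)]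
  decide

/-- `k_3(3) > 0` (Strassen's invariant). [cite: BurgisserIkenmeyer2017, Ex. 5.5] -/
theorem kronRect_three_three_pos : 0 < kronRect ℂ 3 3 := by
  rw [kronRect, kroneckerCoeff_pos_iff_kronSum_pos, Nat.Partition.sortedParts_rectangle 3 3 (by norm_num)]
  decide

/-- **`k_3(δ) > 0` for every `δ ≠ 1`** (Ex. 5.5: "`E'(3) = {0,2,3,4,…}` is generated by `2,3`. Thus
`1` is the only gap"): `δ = 2a + 3b`, the semigroup property of Kronecker coefficients
(`kroneckerCoeff_pos_of_getD_add`) and the two atoms. [cite: BurgisserIkenmeyer2017, Ex. 5.5] -/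
theorem kronRect_three_pos {δ : ℕ} (hδ : δ ≠ 1) : 0 < kronRect ℂ 3 δ := by
  induction δ using Nat.strong_induction_on with
  | _ δ ih =>
    rcases Nat.lt_or_ge δ 4 with h | h
    · interval_cases δ
      · exact kroneckerCoeff_pos_of_size_zero ℂ (by norm_num) _ _ _
      · exact absurd rfl hδ
      · exact kronRect_three_two_pos
      · exact kronRect_three_three_pos
    · have h' := ih (δ - 2) (by omega) (by omega)
      have hrows : ∀ i, (Nat.Partition.rectangle 3 δ).sortedParts.getD i 0 =
          (Nat.Partition.rectangle 3 (δ - 2)).sortedParts.getD i 0 +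
            (Nat.Partition.rectangle 3 2).sortedParts.getD i 0 := by
        intro i
        simp only [getD_sortedParts_rectangle']
        split_ifs <;> omega
      exact kroneckerCoeff_pos_of_getD_add ℂ (by omega) hrows hrows hrows h' kronRect_three_two_pos

/-- `k_3(1) = 0` (Ex. 5.5 table; `3 > 1²`). [cite: BurgisserIkenmeyer2017, Ex. 5.5] -/
theorem kronRect_three_one : kronRect ℂ 3 1 = 0 :=
  kronRect_eq_zero_of_sq_lt ℂ one_pos (by norm_num)

/-- **BI 2017, Ex. 5.5, the degree monoid — PROVED**: `E(3) = {3δ : δ ≠ 1}` ("`E'(3) = {0,2,3,4,…}`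
… `1` is the only gap", with `E(3) = 3 E'(3)`), the second conjunct of the named fact `BI2017_ex_5_5`
(whose first conjunct, the table `k_3(0..12)`, is a SCHUR computation not reproduced here beyond
`k_3(1) = 0` and the positivity of the other entries). [cite: BurgisserIkenmeyer2017, Ex. 5.5] -/
theorem BI2017_ex_5_5_degreeMonoid :
    genericTensorDegreeMonoid (Fin 3) ℂ = {d | ∃ δ : ℕ, d = 3 * δ ∧ δ ≠ 1} := by
  rw [genericTensorDegreeMonoid_eq_kronRect 3]
  ext d
  constructor
  · rintro ⟨δ, rfl, hδ⟩
    refine ⟨δ, rfl, ?_⟩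
    rintro rfl
    rw [kronRect_three_one] at hδ
    exact lt_irrefl 0 hδ
  · rintro ⟨δ, rfl, hδ⟩
    exact ⟨δ, rfl, kronRect_three_pos hδ⟩

/-- **BI 2017, Ex. 5.6: `e'(3) = 2`, i.e. `e(3) = 6` — PROVED.** [cite: BurgisserIkenmeyer2017, Ex. 5.6] -/
theorem BI2017_ex_5_6_three : genericTensorMinimalDegree (Fin 3) ℂ = 6 := by
  unfold genericTensorMinimalDegree
  rw [BI2017_ex_5_5_degreeMonoid]
  have hmem : (6 : ℕ) ∈ {d | d ∈ {d | ∃ δ : ℕ, d = 3 * δ ∧ δ ≠ 1} ∧ 0 < d} :=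
    ⟨⟨2, rfl, by norm_num⟩, by norm_num⟩
  refine le_antisymm (Nat.sInf_le hmem) (le_csInf ⟨_, hmem⟩ ?_)
  rintro d ⟨⟨δ, rfl, hδ⟩, hd⟩
  omega

/-- **BI 2017, Ex. 5.6: `e'(4) = 2`, i.e. `e(4) = 8` — PROVED** (`4 = 2²`, Thm. 5.9(3)).
[cite: BurgisserIkenmeyer2017, Ex. 5.6] -/
theorem BI2017_ex_5_6_four : genericTensorMinimalDegree (Fin 4) ℂ = 8 :=
  BI2017_thm_5_9_part3_minimalDegree 2 (by norm_num)

/-- **BI 2017, Ex. 5.6: `e'(9) = 3`, i.e. `e(9) = 27` — PROVED** (`9 = 3²`).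
[cite: BurgisserIkenmeyer2017, Ex. 5.6] -/
theorem BI2017_ex_5_6_nine : genericTensorMinimalDegree (Fin 9) ℂ = 27 :=
  BI2017_thm_5_9_part3_minimalDegree 3 (by norm_num)

/-- **BI 2017, Ex. 5.6: `e'(16) = 4`, i.e. `e(16) = 64` — PROVED** (`16 = 4²`).
[cite: BurgisserIkenmeyer2017, Ex. 5.6] -/
theorem BI2017_ex_5_6_sixteen : genericTensorMinimalDegree (Fin 16) ℂ = 64 :=
  BI2017_thm_5_9_part3_minimalDegree 4 (by norm_num)

/-- **BI 2017, Ex. 5.6 / Rem. 5.18 table: `k_4(2) = k_9(3) = k_{16}(4) = 1`** ("`k_m(e'(m)) = 1` for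
`m = 2,3,4,5,6,8,9,14,15,16`" — the square cases, Thm. 5.9(3)). [cite: BurgisserIkenmeyer2017, Rem. 5.18] -/
theorem BI2017_rem_5_18_squares : kronRect ℂ 4 2 = 1 ∧ kronRect ℂ 9 3 = 1 ∧ kronRect ℂ 16 4 = 1 :=
  ⟨kronRect_sq_eq_one ℂ 2, kronRect_sq_eq_one ℂ 3, kronRect_sq_eq_one ℂ 4⟩

/-- **Locating the generic minimal degree**: if `k_m(δ₀) > 0`, `δ₀ > 0` and `(δ₀ - 1)² < m` (so that
`k_m(δ) = 0` for `0 < δ < δ₀` by the bound of Thm. 5.9(1)), then `e(m) = m δ₀` (`m ≥ 1`).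
[cite: BurgisserIkenmeyer2017, Ex. 5.6] -/
theorem genericTensorMinimalDegree_eq_of_kronRect_pos {m δ₀ : ℕ} (hm : 0 < m) (hδ₀ : 0 < δ₀)
    (hpos : 0 < kronRect ℂ m δ₀) (hlt : (δ₀ - 1) ^ 2 < m) :
    genericTensorMinimalDegree (Fin m) ℂ = m * δ₀ := by
  have hE := genericTensorDegreeMonoid_eq_kronRect m
  unfold genericTensorMinimalDegree
  rw [hE]
  have hmem : m * δ₀ ∈ {d | d ∈ {d | ∃ δ : ℕ, d = m * δ ∧ 0 < kronRect ℂ m δ} ∧ 0 < d} :=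
    ⟨⟨δ₀, rfl, hpos⟩, Nat.mul_pos hm hδ₀⟩
  refine le_antisymm (Nat.sInf_le hmem) (le_csInf ⟨_, hmem⟩ ?_)
  rintro d ⟨⟨δ, rfl, hδ⟩, hd⟩
  have hδ0 : 0 < δ := Nat.pos_of_ne_zero (by rintro rfl; simp at hd)
  have h := le_sq_of_kronRect_pos ℂ hδ0 hδ
  refine Nat.mul_le_mul_left m ?_
  by_contra hlt'
  have hle : δ ≤ δ₀ - 1 := by omega
  have : δ ^ 2 ≤ (δ₀ - 1) ^ 2 := Nat.pow_le_pow_left hle 2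
  omega

/-- **`k_4(3) > 0`, `k_5(3) > 0`, `k_6(3) > 0`, `k_8(3) > 0`** (Ex. 5.6: `3 ∈ E'(4)`, and `k_5(3) =
k_6(3) = k_8(3) = 1` by Rem. 5.18), certified in the kernel by the tree's Murnaghan–Nakayama evaluator
(`S_12`, `S_15`, `S_18`, `S_24`). [cite: BurgisserIkenmeyer2017, Ex. 5.6 and Rem. 5.18] -/
theorem kronRect_four_three_pos : 0 < kronRect ℂ 4 3 := by
  rw [kronRect, kroneckerCoeff_pos_iff_kronSum_pos, Nat.Partition.sortedParts_rectangle 4 3 (by norm_num)]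
  set_option maxHeartbeats 100000000 in
  set_option maxRecDepth 100000 in
  decide +kernel

/-- `k_5(3) > 0`. [cite: BurgisserIkenmeyer2017, Rem. 5.18] -/
theorem kronRect_five_three_pos : 0 < kronRect ℂ 5 3 := by
  rw [kronRect, kroneckerCoeff_pos_iff_kronSum_pos, Nat.Partition.sortedParts_rectangle 5 3 (by norm_num)]
  set_option maxHeartbeats 100000000 in
  set_option maxRecDepth 100000 in
  decide +kernel

/-- `k_6(3) > 0`. [cite: BurgisserIkenmeyer2017, Rem. 5.18] -/
theorem kronRect_six_three_pos : 0 < kronRect ℂ 6 3 := by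
  rw [kronRect, kroneckerCoeff_pos_iff_kronSum_pos, Nat.Partition.sortedParts_rectangle 6 3 (by norm_num)]
  set_option maxHeartbeats 100000000 in
  set_option maxRecDepth 100000 in
  decide +kernel

/-- `k_8(3) > 0` (`S_24`; about a minute of kernel time). [cite: BurgisserIkenmeyer2017, Rem. 5.18] -/
theorem kronRect_eight_three_pos : 0 < kronRect ℂ 8 3 := by
  rw [kronRect, kroneckerCoeff_pos_iff_kronSum_pos, Nat.Partition.sortedParts_rectangle 8 3 (by norm_num)]
  set_option maxHeartbeats 100000000 in
  set_option maxRecDepth 100000 in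
  decide +kernel

/-- **`k_4(δ) > 0` for every `δ ≠ 1`** (Ex. 5.6: "`E'(4) = E'(3) = {0,2,3,4,…}`"): atoms `k_4(2) = 1`
(the square case) and `k_4(3) > 0`, then the semigroup property. [cite: BurgisserIkenmeyer2017, Ex. 5.6] -/
theorem kronRect_four_pos {δ : ℕ} (hδ : δ ≠ 1) : 0 < kronRect ℂ 4 δ := by
  induction δ using Nat.strong_induction_on with
  | _ δ ih =>
    rcases Nat.lt_or_ge δ 4 with h | h
    · interval_cases δ
      · exact kroneckerCoeff_pos_of_size_zero ℂ (by norm_num) _ _ _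
      · exact absurd rfl hδ
      · exact kronRect_sq_pos ℂ 2
      · exact kronRect_four_three_pos
    · have h' := ih (δ - 2) (by omega) (by omega)
      have hrows : ∀ i, (Nat.Partition.rectangle 4 δ).sortedParts.getD i 0 =
          (Nat.Partition.rectangle 4 (δ - 2)).sortedParts.getD i 0 +
            (Nat.Partition.rectangle 4 2).sortedParts.getD i 0 := by
        intro i
        simp only [getD_sortedParts_rectangle']
        split_ifs <;> omega
      exact kroneckerCoeff_pos_of_getD_add ℂ (by omega) hrows hrows hrows h' (kronRect_sq_pos ℂ 2)

/-- **BI 2017, Ex. 5.6: `E(4) = {4δ : δ ≠ 1}`** ("`E'(4) = E'(3) = {0,2,3,4,…}`"), i.e. the `m = 4`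
instance of the shape clause `E(m) = {0} ∪ (e(m) + mℕ)` of the named fact `BI2017_ex_5_6`.
[cite: BurgisserIkenmeyer2017, Ex. 5.6] -/
theorem BI2017_ex_5_6_degreeMonoid_four :
    genericTensorDegreeMonoid (Fin 4) ℂ = {d | ∃ δ : ℕ, d = 4 * δ ∧ δ ≠ 1} := by
  rw [genericTensorDegreeMonoid_eq_kronRect 4]
  ext d
  constructor
  · rintro ⟨δ, rfl, hδ⟩
    refine ⟨δ, rfl, ?_⟩
    rintro rfl
    rw [kronRect_eq_zero_of_sq_lt ℂ one_pos (by norm_num)] at hδ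
    exact lt_irrefl 0 hδ
  · rintro ⟨δ, rfl, hδ⟩
    exact ⟨δ, rfl, kronRect_four_pos hδ⟩

/-- **BI 2017, Ex. 5.6: `e'(5) = 3`, i.e. `e(5) = 15` — PROVED** (`k_5(3) > 0`; `k_5(1) = k_5(2) = 0`
as `1, 4 < 5`). [cite: BurgisserIkenmeyer2017, Ex. 5.6] -/
theorem BI2017_ex_5_6_five : genericTensorMinimalDegree (Fin 5) ℂ = 15 :=
  genericTensorMinimalDegree_eq_of_kronRect_pos (by norm_num) (by norm_num) kronRect_five_three_pos
    (by norm_num)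

/-- **BI 2017, Ex. 5.6: `e'(6) = 3`, i.e. `e(6) = 18` — PROVED.** [cite: BurgisserIkenmeyer2017, Ex. 5.6] -/
theorem BI2017_ex_5_6_six : genericTensorMinimalDegree (Fin 6) ℂ = 18 :=
  genericTensorMinimalDegree_eq_of_kronRect_pos (by norm_num) (by norm_num) kronRect_six_three_pos
    (by norm_num)

/-- **BI 2017, Ex. 5.6: `e'(8) = 3`, i.e. `e(8) = 24` — PROVED.** (`e'(7) = 4` would need `k_7(4) > 0`
in `S_28`, beyond the kernel evaluator's reach.) [cite: BurgisserIkenmeyer2017, Ex. 5.6] -/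
theorem BI2017_ex_5_6_eight : genericTensorMinimalDegree (Fin 8) ℂ = 24 :=
  genericTensorMinimalDegree_eq_of_kronRect_pos (by norm_num) (by norm_num) kronRect_eight_three_pos
    (by norm_num)

end Examples

/-! ### §9 BI 2017, Thm. 5.9 (2): the Alon–Tarsi clause, in the word model -/

section AlonTarsi

variable (k : Type*) [Field k] [CharZero k] {m D b N : ℕ}

/-- **The block sign of a word** on `D` positions over the alphabet `[0,N)`, read through a block
structure `e : Fin D ≃ Fin b × Fin N` (`b` blocks of `N` positions; blocks = fibres of the first
coordinate, ordered by the second): the product over the blocks of the signs of the sequences of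
letters in the blocks if every block carries each letter exactly once, and `0` otherwise — the
coordinate function of the `SL_N`-invariant `ζ = (e_1 ∧ ⋯ ∧ e_N)^{⊗ b} ∈ ⊗^{D} k^N` of BI's proofs of
Thm. 5.9(2) (`N = b = m`: "`ζ` has the wedge list `(1,…,m), (m+1,…,2m), …`"; `ζᵗ` is `ζ` for the
transposed block structure) and of Thm. 5.13 (`N = n²`, `b = n`, "wedge lists" = slices of the cube).
[cite: BurgisserIkenmeyer2017, Thm. 5.9 (proof of (2))] -/
def wordBlockSign (e : Fin D ≃ Fin b × Fin N) (u : Word N D) : k :=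
  if ∀ a, Function.Bijective (fun j => u (e.symm (a, j))) then
    ∏ a, (((Kumar2015.seqSign (fun j => u (e.symm (a, j))) : ℤˣ) : ℤ) : k) else 0

/-- Row-major blocks: position `finProdFinEquiv (a, b)` lies in block (row) `a`. [folklore] -/
abbrev rowBlocks (m : ℕ) : Fin (m * m) ≃ Fin m × Fin m := finProdFinEquiv.symm

/-- Column blocks: position `finProdFinEquiv (a, b)` lies in block (column) `b`. [folklore] -/
abbrev colBlocks (m : ℕ) : Fin (m * m) ≃ Fin m × Fin m :=
  finProdFinEquiv.symm.trans (Equiv.prodComm (Fin m) (Fin m))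

/-- **The Latin-square triple tensor** `ζᵗ ⊗ ζ ⊗ ζ` of BI's proof of Thm. 5.9(2), as a function on
triples of words on `m²` positions: column-block sign of the first word times the row-block signs
of the other two. [cite: BurgisserIkenmeyer2017, Thm. 5.9 (proof of (2))] -/
def latinSquareTensor (m : ℕ) (t : Word3 m (m * m)) : k :=
  wordBlockSign k (colBlocks m) t.1.1 * wordBlockSign k (rowBlocks m) t.1.2 * wordBlockSign k (rowBlocks m) t.2

omit [CharZero k] in
/-- The Leibniz expansion over all MAPS `[m] → [m]`, non-bijective ones weighted `0`:
`∑_f sgn(f) ∏_b V[b, f(b)] = det V` (plumbing; as in `BI17FundamentalTensorInvariantProofs`).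
[folklore] -/
private theorem sum_ite_bijective_mul_prod_eq_det (V : Matrix (Fin N) (Fin N) k) :
    ∑ f : Fin N → Fin N, (if Function.Bijective f then
        (((Kumar2015.seqSign f : ℤˣ) : ℤ) : k) else 0) * ∏ b, V b (f b) = V.det := by
  classical
  rw [← Matrix.det_transpose, Matrix.det_apply']
  have himage : (Finset.univ : Finset (Fin N → Fin N)).filter Function.Bijective =
      Finset.univ.image fun σ : Equiv.Perm (Fin N) => (σ : Fin N → Fin N) := by
    ext f
    simp only [Finset.mem_filter, Finset.mem_univ, true_and, Finset.mem_image]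
    exact ⟨fun hf => ⟨Equiv.ofBijective f hf, rfl⟩, fun ⟨σ, hσ⟩ => hσ ▸ σ.bijective⟩
  rw [← Finset.sum_filter_add_sum_filter_not Finset.univ Function.Bijective]
  have h0 : ∑ f ∈ Finset.univ.filter (fun f : Fin N → Fin N => ¬ Function.Bijective f),
      (if Function.Bijective f then (((Kumar2015.seqSign f : ℤˣ) : ℤ) : k) else 0) * ∏ b, V b (f b) = 0 :=
    Finset.sum_eq_zero fun f hf => by
      rw [Finset.mem_filter] at hf
      rw [if_neg hf.2, zero_mul]
  rw [h0, add_zero, himage, Finset.sum_image fun σ _ τ _ h => Equiv.ext (congrFun h)]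
  refine Finset.sum_congr rfl fun σ _ => ?_
  rw [if_pos σ.bijective, Kumar2015.seqSign_coe_perm]
  rfl

/-- Words on `m²` positions are block-by-block families of words on `m` positions (plumbing).
[folklore] -/
private def blockCurry (e : Fin D ≃ Fin b × Fin N) : Word N D ≃ (Fin b → Fin N → Fin N) where
  toFun u := fun a j => u (e.symm (a, j))
  invFun R := fun p => R (e p).1 (e p).2
  left_inv u := by funext p; simp
  right_inv R := by funext a b; simp

omit [CharZero k] in
/-- `det` of the rows `r(0), …, r(m-1)` of `G`: `sgn(r) det G` if `r` is a bijection, `0` otherwise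
(plumbing). [folklore] -/
private theorem det_submatrix_eq_ite (G : Matrix (Fin N) (Fin N) k) (r : Fin N → Fin N) :
    (G.submatrix r id).det = (if Function.Bijective r then
        (((Kumar2015.seqSign r : ℤˣ) : ℤ) : k) else 0) * G.det := by
  classical
  by_cases hr : Function.Bijective r
  · rw [if_pos hr]
    have h := Matrix.det_permute (Equiv.ofBijective r hr) G
    rw [Equiv.coe_ofBijective] at h
    rw [h, ← Kumar2015.seqSign_coe_perm (Equiv.ofBijective r hr), Equiv.coe_ofBijective]
  · rw [if_neg hr, zero_mul]
    have hinj : ¬ Function.Injective r := fun h => hr (Finite.injective_iff_bijective.1 h)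
    obtain ⟨i, j, hij, hne⟩ := Function.not_injective_iff.1 hinj
    exact Matrix.det_zero_of_row_eq hne (by funext l; simp [Matrix.submatrix_apply, hij])

omit [CharZero k] in
/-- **`GL_N` acts on the block sign by `det^b`** (`b` blocks of the `N` letters): `g · ζ_e =
det(g)^b ζ_e` in the word model, for every `g ∈ GL_N` and every block structure `e` — summing over
the letters block by block gives a product of `b` determinants `det (g_{u'(a,j), l})_{j,l} =
sgn(u'_a) det g` (BI: "each contraction … is a product of determinants").
[cite: BurgisserIkenmeyer2017, Thm. 5.9 (proof of (2))] -/
theorem wordRep_wordBlockSign (e : Fin D ≃ Fin b × Fin N) (g : GL (Fin N) k) :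
    wordRep k N D g (wordBlockSign k e) = ((g : Matrix (Fin N) (Fin N) k).det ^ b) • wordBlockSign k e := by
  classical
  set G : Matrix (Fin N) (Fin N) k := (g : Matrix (Fin N) (Fin N) k) with hG
  funext u'
  rw [wordRep_apply, Pi.smul_apply, smul_eq_mul]
  -- regroup the sum over words block by block
  have hsum : ∑ u : Word N D, (∏ p, G (u' p) (u p)) * wordBlockSign k e u =
      ∏ a, ∑ v : Fin N → Fin N, (if Function.Bijective v then
        (((Kumar2015.seqSign v : ℤˣ) : ℤ) : k) else 0) * ∏ b, G (u' (e.symm (a, b))) (v b) := by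
    rw [Finset.prod_univ_sum, Fintype.piFinset_univ]
    refine Fintype.sum_equiv (blockCurry e) _ _ fun u => ?_
    have hprod : (∏ p, G (u' p) (u p)) = ∏ a, ∏ b, G (u' (e.symm (a, b))) (u (e.symm (a, b))) := by
      rw [← Finset.prod_product', Finset.univ_product_univ]
      exact (Fintype.prod_equiv e.symm _ _ fun _ => rfl).symm
    by_cases hb : ∀ a, Function.Bijective (fun b => u (e.symm (a, b)))
    · rw [wordBlockSign, if_pos hb, hprod, ← Finset.prod_mul_distrib]
      refine Finset.prod_congr rfl fun a _ => ?_
      simp only [blockCurry, Equiv.coe_fn_mk]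
      rw [if_pos (hb a), mul_comm]
    · rw [wordBlockSign, if_neg hb, mul_zero]
      push Not at hb
      obtain ⟨a, ha⟩ := hb
      symm
      apply Finset.prod_eq_zero (Finset.mem_univ a)
      simp only [blockCurry, Equiv.coe_fn_mk]
      rw [if_neg ha, zero_mul]
  rw [hsum]
  -- each factor is a determinant: `det` of the rows `u'(a, ·)` of `G`
  have hdet : ∀ a, ∑ v : Fin N → Fin N, (if Function.Bijective v then
        (((Kumar2015.seqSign v : ℤˣ) : ℤ) : k) else 0) * ∏ b, G (u' (e.symm (a, b))) (v b) =
      (if Function.Bijective (fun b => u' (e.symm (a, b))) then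
        (((Kumar2015.seqSign (fun b => u' (e.symm (a, b))) : ℤˣ) : ℤ) : k) else 0) * G.det := by
    intro a
    rw [← det_submatrix_eq_ite, ← sum_ite_bijective_mul_prod_eq_det]
    rfl
  simp_rw [hdet]
  rw [Finset.prod_mul_distrib, Finset.prod_const, Finset.card_univ, Fintype.card_fin, mul_comm]
  congr 1
  -- the product of the block factors is the block sign
  by_cases hb : ∀ a, Function.Bijective (fun b => u' (e.symm (a, b)))
  · rw [wordBlockSign, if_pos hb]
    exact Finset.prod_congr rfl fun a _ => if_pos (hb a)
  · rw [wordBlockSign, if_neg hb]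
    push Not at hb
    obtain ⟨a, ha⟩ := hb
    exact Finset.prod_eq_zero (Finset.mem_univ a) (if_neg ha)

omit [CharZero k] in
/-- **The block sign is a highest-weight vector of the rectangular weight `(b,…,b)`** (`N`
parts; a `B`-semi-invariant of weight `det^b`). [cite: BurgisserIkenmeyer2017, Thm. 5.9 (proof of (2))] -/
theorem wordBlockSign_mem_highestWeightSpace (e : Fin D ≃ Fin b × Fin N) :
    wordBlockSign k e ∈ highestWeightSpace (wordRep k N D)
      (Weight.ofPartition N (Nat.Partition.rectangle N b)) := by
  intro g hg
  rw [wordRep_wordBlockSign, weightChar_ofPartition_rectangle hg]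

omit [CharZero k] in
/-- **The Latin-square tensor lies in `HW_□ ⊗ HW_□ ⊗ HW_□`** (`□ = (m,…,m)`): each partial function
is a scalar multiple of a block sign. [cite: BurgisserIkenmeyer2017, Thm. 5.9 (proof of (2))] -/
theorem latinSquareTensor_mem_tripleHw (m : ℕ) :
    latinSquareTensor k m ∈ tripleHw k m (m * m) (Weight.ofPartition m (Nat.Partition.rectangle m m))
      (Weight.ofPartition m (Nat.Partition.rectangle m m))
      (Weight.ofPartition m (Nat.Partition.rectangle m m)) := by
  rw [mem_tripleHw_iff]
  refine ⟨fun w₂ w₃ => ?_, fun w₁ w₃ => ?_, fun w₁ w₂ => ?_⟩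
  · have h : (fun w₁ => latinSquareTensor k m ((w₁, w₂), w₃)) =
        (wordBlockSign k (rowBlocks m) w₂ * wordBlockSign k (rowBlocks m) w₃) • wordBlockSign k (colBlocks m) := by
      funext w₁; simp only [latinSquareTensor, Pi.smul_apply, smul_eq_mul]; ring
    rw [h]
    exact Submodule.smul_mem _ _ (wordBlockSign_mem_highestWeightSpace k _)
  · have h : (fun w₂ => latinSquareTensor k m ((w₁, w₂), w₃)) =
        (wordBlockSign k (colBlocks m) w₁ * wordBlockSign k (rowBlocks m) w₃) • wordBlockSign k (rowBlocks m) := by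
      funext w₂; simp only [latinSquareTensor, Pi.smul_apply, smul_eq_mul]; ring
    rw [h]
    exact Submodule.smul_mem _ _ (wordBlockSign_mem_highestWeightSpace k _)
  · have h : (fun w₃ => latinSquareTensor k m ((w₁, w₂), w₃)) =
        (wordBlockSign k (colBlocks m) w₁ * wordBlockSign k (rowBlocks m) w₂) • wordBlockSign k (rowBlocks m) := by
      funext w₃; simp only [latinSquareTensor, Pi.smul_apply, smul_eq_mul]
    rw [h]
    exact Submodule.smul_mem _ _ (wordBlockSign_mem_highestWeightSpace k _)

omit [CharZero k] in
/-- **The symmetrised Latin-square tensor lies in `symTripleHw □ □ □`** — the word-model avatar of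
BI's invariant `P = Ψ(ζ ⊗ ζᵗ ⊗ ζᵗ) ∈ O(⊗³ℂ^m)_{m²}`. [cite: BurgisserIkenmeyer2017, Thm. 5.9 (proof of (2))] -/
theorem sym3_latinSquareTensor_mem_symTripleHw (m : ℕ) :
    sym3 (latinSquareTensor k m) ∈ symTripleHw k m (m * m) (Weight.ofPartition m (Nat.Partition.rectangle m m))
      (Weight.ofPartition m (Nat.Partition.rectangle m m))
      (Weight.ofPartition m (Nat.Partition.rectangle m m)) :=
  (mem_symTripleHw_iff _ _ _ _).2 ⟨sym3_mem_tripleHw (latinSquareTensor_mem_tripleHw k m), sym3_permute3 _⟩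

omit [CharZero k] in
/-- The diagonal trace of a symmetrisation: `∑_u (∑_τ H)(u,u,u) = (m²)! ∑_u H(u,u,u)` (plumbing).
[folklore] -/
private theorem sum_sym3_diag {n N : ℕ} (H : Word3 N n → k) :
    ∑ u : Word N n, sym3 H ((u, u), u) = (Nat.factorial n : k) * ∑ u : Word N n, H ((u, u), u) := by
  simp only [sym3]
  rw [Finset.sum_comm]
  have h : ∀ τ : Equiv.Perm (Fin n), ∑ u : Word N n, H (permute3 τ ((u, u), u)) =
      ∑ u : Word N n, H ((u, u), u) := by
    intro τ
    exact Fintype.sum_equiv (Equiv.arrowCongr τ (Equiv.refl (Fin N))).symm _ _ fun u => by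
      simp only [permute3, Equiv.arrowCongr_symm]
      rfl
  simp_rw [h]
  rw [Finset.sum_const, Finset.card_univ, Fintype.card_perm, Fintype.card_fin, nsmul_eq_mul]

omit [CharZero k] in
/-- `sgn² = 1` for the cast of a unit of `ℤ` (plumbing). [folklore] -/
private theorem cast_units_mul_self (s : ℤˣ) : (((s : ℤ) : k)) * ((s : ℤ) : k) = 1 := by
  rw [← Int.cast_mul, ← Units.val_mul, Int.units_mul_self, Units.val_one, Int.cast_one]

omit [CharZero k] in
/-- **The Latin-square tensor on the diagonal**: `(ζᵗ ⊗ ζ ⊗ ζ)(u, u, u)` is the column sign of the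
square array `R = u` (rows = row blocks) if `R` is a Latin square, and `0` otherwise — BI: "the
numbers `i_{1,1}, …, i_{m,m}` must form a Latin square `T` … the product of the signs of the
permutations in the columns of `T`". [cite: BurgisserIkenmeyer2017, Thm. 5.9 (proof of (2))] -/
theorem latinSquareTensor_diag [DecidablePred (Kumar2015.IsLatinRect (i := m) (m := m))] (u : Word m (m * m)) :
    latinSquareTensor k m ((u, u), u) =
      if Kumar2015.IsLatinRect (fun a b => u (finProdFinEquiv (a, b))) then
        (((Kumar2015.rectColSign (fun a b => u (finProdFinEquiv (a, b))) : ℤˣ) : ℤ) : k) else 0 := by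
  classical
  set R : Fin m → Fin m → Fin m := fun a b => u (finProdFinEquiv (a, b)) with hR
  have hrow : wordBlockSign k (rowBlocks m) u =
      if ∀ a, Function.Bijective (R a) then
        ∏ a, (((Kumar2015.seqSign (R a) : ℤˣ) : ℤ) : k) else 0 := rfl
  have hcol : wordBlockSign k (colBlocks m) u =
      if ∀ c, Function.Bijective (fun d => R d c) then
        ∏ c, (((Kumar2015.seqSign (fun d => R d c) : ℤˣ) : ℤ) : k) else 0 := rfl
  rw [latinSquareTensor, hrow, hcol]
  by_cases hr : ∀ a, Function.Bijective (R a)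
  · by_cases hc : ∀ c, Function.Bijective (fun d => R d c)
    · have hL : Kumar2015.IsLatinRect R := ⟨hr, fun j => (hc j).1⟩
      rw [if_pos hr, if_pos hc, if_pos hL, mul_assoc, ← Finset.prod_mul_distrib,
        Finset.prod_eq_one (fun a _ => cast_units_mul_self k _), mul_one, Kumar2015.rectColSign,
        Units.coe_prod, Int.cast_prod]
    · have hL : ¬ Kumar2015.IsLatinRect R := fun h => hc fun j =>
        Finite.injective_iff_bijective.1 (h.2 j)
      rw [if_neg hc, if_neg hL, zero_mul, zero_mul]
  · have hL : ¬ Kumar2015.IsLatinRect R := fun h => hr h.1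
    rw [if_neg hr, if_neg hL, mul_zero]

omit [CharZero k] in
/-- **`∑_u (ζᵗ ⊗ ζ ⊗ ζ)(u,u,u) = ♯CELS(m) − ♯COLS(m)`**, the column-signed count of Latin squares
(`Kumar2015.latinColCount`; BI: "`P(⟨m⟩)` is the difference between the number of column-even and
the number of column-odd Latin squares of order `m`").
[cite: BurgisserIkenmeyer2017, Thm. 5.9 (proof of (2))] -/
theorem sum_latinSquareTensor_diag (m : ℕ) :
    ∑ u : Word m (m * m), latinSquareTensor k m ((u, u), u) = ((Kumar2015.latinColCount m : ℤ) : k) := by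
  classical
  simp_rw [latinSquareTensor_diag]
  rw [Kumar2015.latinColCount, Int.cast_sum, Finset.sum_filter]
  exact Fintype.sum_equiv (blockCurry (rowBlocks m))
    (fun u : Word m (m * m) => if Kumar2015.IsLatinRect (fun a b => u (finProdFinEquiv (a, b))) then
        (((Kumar2015.rectColSign (fun a b => u (finProdFinEquiv (a, b))) : ℤˣ) : ℤ) : k) else 0)
    (fun R => if Kumar2015.IsLatinRect R then (((Kumar2015.rectColSign R : ℤˣ) : ℤ) : k) else 0)
    (fun u => by simp only [blockCurry, rowBlocks, Equiv.coe_fn_mk, Equiv.symm_symm])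

/-- **Alon–Tarsi ⇒ the symmetrised Latin-square tensor is nonzero** (`♯CELS(m) ≠ ♯COLS(m)` ⇒
`P ≠ 0`, BI's proof of Thm. 5.9(2)): its diagonal trace is `(m²)! · (♯CELS(m) − ♯COLS(m))`.
[cite: BurgisserIkenmeyer2017, Thm. 5.9 (proof of (2))] -/
theorem sym3_latinSquareTensor_ne_zero (hAT : Kumar2015.latinColCount m ≠ 0) :
    sym3 (latinSquareTensor k m) ≠ 0 := by
  intro h
  have hsum := sum_sym3_diag k (latinSquareTensor k m)
  rw [h, sum_latinSquareTensor_diag] at hsum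
  simp only [Pi.zero_apply, Finset.sum_const_zero] at hsum
  have : (Nat.factorial (m * m) : k) * ((Kumar2015.latinColCount m : ℤ) : k) ≠ 0 :=
    mul_ne_zero (Nat.cast_ne_zero.2 (Nat.factorial_ne_zero _)) (Int.cast_ne_zero.2 hAT)
  exact this hsum.symm

/-- **Alon–Tarsi ⇒ `k_m(m) > 0`** (`dim O(⊗³k^m)^{SL³_m}_{m²} = k_m(m)` and the space contains
`P ≠ 0`). [cite: BurgisserIkenmeyer2017, Thm. 5.9 (2)] -/
theorem kronRect_self_pos_of_latinColCount_ne_zero (hAT : Kumar2015.latinColCount m ≠ 0) :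
    0 < kronRect k m m := by
  rw [kronRect, ← finrank_symTripleHw _ _ _ (Nat.Partition.card_parts_rectangle_le m m)
    (Nat.Partition.card_parts_rectangle_le m m) (Nat.Partition.card_parts_rectangle_le m m),
    Module.finrank_pos_iff_exists_ne_zero]
  refine ⟨⟨sym3 (latinSquareTensor k m), sym3_latinSquareTensor_mem_symTripleHw k m⟩, ?_⟩
  intro h
  exact sym3_latinSquareTensor_ne_zero k hAT (congrArg Subtype.val h)

/-- **Alon–Tarsi ⇒ `m² ∈ E(m)`** (`m ≥ 1`): there is a nonzero `SL³_m`-invariant of degree `m²` on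
`⊗³ℂ^m` (any `m`). [cite: BurgisserIkenmeyer2017, Thm. 5.9 (2)] -/
theorem sq_mem_genericTensorDegreeMonoid_of_latinColCount_ne_zero
    (hAT : Kumar2015.latinColCount m ≠ 0) : m * m ∈ genericTensorDegreeMonoid (Fin m) ℂ := by
  rw [genericTensorDegreeMonoid_eq_kronRect m]
  exact ⟨m, rfl, kronRect_self_pos_of_latinColCount_ne_zero ℂ hAT⟩

/-- **BI 2017, Thm. 5.9 (2) — PROVED: "`e'(m) ≤ m` if the Alon–Tarsi conjecture holds for `m`"**,
typed as `AT(m) := ♯CELS(m) ≠ ♯COLS(m)` (`Kumar2015.latinColCount m ≠ 0`) `⇒ e(m) ≤ m²` (`m ≥ 1`;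
print `m > 2` through `a(m) = 1`). [cite: BurgisserIkenmeyer2017, Thm. 5.9 (2)] -/
theorem BI2017_thm_5_9_part2 (m : ℕ) (hm : 0 < m) (hAT : Kumar2015.latinColCount m ≠ 0) :
    genericTensorMinimalDegree (Fin m) ℂ ≤ m * m :=
  Nat.sInf_le ⟨sq_mem_genericTensorDegreeMonoid_of_latinColCount_ne_zero hAT, Nat.mul_pos hm hm⟩

/-- Alon–Tarsi for `m` also gives what part (1) needs: `e(m) > 0`. [cite: BurgisserIkenmeyer2017, Thm. 5.9 (2)] -/
theorem genericTensorMinimalDegree_pos_of_latinColCount_ne_zero (hm : 0 < m)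
    (hAT : Kumar2015.latinColCount m ≠ 0) : 0 < genericTensorMinimalDegree (Fin m) ℂ := by
  have hne : {d | d ∈ genericTensorDegreeMonoid (Fin m) ℂ ∧ 0 < d}.Nonempty :=
    ⟨m * m, sq_mem_genericTensorDegreeMonoid_of_latinColCount_ne_zero hAT, Nat.mul_pos hm hm⟩
  exact (Nat.sInf_mem hne).2

/-- **BI 2017, Thm. 5.9, assembled: the named fact `BI2017_thm_5_9` holds as soon as the generic
minimal degree `e(m)` is positive for every `m > 2`** (existence of a non-constant `SL³_m`-invariant
on `⊗³ℂ^m`; implicit in print). Parts (2), (3), and (1) given positivity, are theorems of this file.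
[cite: BurgisserIkenmeyer2017, Thm. 5.9] -/
theorem BI2017_thm_5_9_of_pos (hpos : ∀ m : ℕ, 2 < m → 0 < genericTensorMinimalDegree (Fin m) ℂ) :
    BI2017_thm_5_9 :=
  BI2017_thm_5_9_of_pos_of_alonTarsi hpos fun m hm hAT => BI2017_thm_5_9_part2 m (by omega) hAT

end AlonTarsi

/-! ### §10 BI 2017, Thm. 5.13: `F_n ≠ 0` -/

section FundamentalInvariant

variable (k : Type*) [Field k] [CharZero k] (n : ℕ)

/-! #### Block-sign calculus: position permutations, swaps inside a block, re-ordered blocks -/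

omit [CharZero k] in
/-- **Position permutations transport block structures** ("the action of `S_d³` permutes the
entries in these lists"): `ζ_e(u ∘ ρ) = ζ_{ρ⁻¹·e}(u)` with `ρ⁻¹·e = ρ.symm.trans e`.
[cite: BurgisserIkenmeyer2017, Thm. 5.13 (proof)] -/
theorem wordBlockSign_comp_perm {D b N : ℕ} (e : Fin D ≃ Fin b × Fin N) (ρ : Equiv.Perm (Fin D))
    (u : Word N D) : wordBlockSign k e (u ∘ ⇑ρ) = wordBlockSign k (ρ.symm.trans e) u :=
  rfl

omit [CharZero k] in
/-- The position action `wordPerm` of `S_D` permutes the block signs: `σ · ζ_e = ζ_{σ⁻¹·e}`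
("the action of `S_d³` permutes the entries in these lists").
[cite: BurgisserIkenmeyer2017, Thm. 5.13 (proof)] -/
theorem wordPerm_wordBlockSign {D b N : ℕ} (e : Fin D ≃ Fin b × Fin N) (σ : Equiv.Perm (Fin D)) :
    wordPerm k σ (wordBlockSign k e) = wordBlockSign k (σ.symm.trans e) := by
  funext u
  rw [wordPerm_apply]
  rfl

omit [CharZero k] in
/-- The block sign of the word "position ↦ its place inside its block" is `1`: every block carries
the identity sequence (plumbing). [folklore] -/
private theorem wordBlockSign_apply_blockPlace {D b N : ℕ} (e : Fin D ≃ Fin b × Fin N) :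
    wordBlockSign k e (fun p => (e p).2) = 1 := by
  have hid : ∀ a : Fin b, (fun j : Fin N => (e (e.symm (a, j))).2) = ⇑(1 : Equiv.Perm (Fin N)) :=
    fun a => by funext j; simp
  unfold wordBlockSign
  simp only [hid]
  rw [if_pos fun _ => (1 : Equiv.Perm (Fin N)).bijective]
  exact Finset.prod_eq_one fun a _ => by
    rw [Kumar2015.seqSign_coe_perm, Equiv.Perm.sign_one, Units.val_one, Int.cast_one]

omit [CharZero k] in
/-- **Block signs are nonzero** (`ζ = (e_1 ∧ ⋯ ∧ e_N)^{⊗b} ≠ 0`: it takes the value `1` on the word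
"position ↦ its place inside its block"). [cite: BurgisserIkenmeyer2017, Thm. 5.13 (proof)] -/
theorem wordBlockSign_ne_zero {D b N : ℕ} (e : Fin D ≃ Fin b × Fin N) : wordBlockSign k e ≠ 0 :=
  fun h => one_ne_zero ((wordBlockSign_apply_blockPlace k e).symm.trans (congrFun h _))

omit [CharZero k] in
/-- **Swapping two positions of one block flips the block sign**: if `q ≠ q'` lie in the same
block of `e` then `ζ_e(u ∘ (q q')) = -ζ_e(u)` — the alternating property of `e_1 ∧ ⋯ ∧ e_N`
(BI: "If only entries inside a block are changed, then, up to sign, `P_t` does not change").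
[cite: BurgisserIkenmeyer2017, Thm. 5.13 (proof)] -/
theorem wordBlockSign_comp_swap {D b N : ℕ} (e : Fin D ≃ Fin b × Fin N) {q q' : Fin D}
    (hqq' : q ≠ q') (hblock : (e q).1 = (e q').1) (u : Word N D) :
    wordBlockSign k e (u ∘ ⇑(Equiv.swap q q')) = -wordBlockSign k e u := by
  classical
  have hjj : (e q).2 ≠ (e q').2 := by
    intro h
    exact hqq' (e.injective (Prod.ext hblock h))
  have hq : e.symm ((e q).1, (e q).2) = q := by rw [Prod.mk.eta, Equiv.symm_apply_apply]
  have hq' : e.symm ((e q).1, (e q').2) = q' := by rw [hblock, Prod.mk.eta, Equiv.symm_apply_apply]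
  have hne : ∀ a j, (a, j) ≠ e q → (a, j) ≠ e q' →
      Equiv.swap q q' (e.symm (a, j)) = e.symm (a, j) := by
    intro a j h1 h2
    apply Equiv.swap_apply_of_ne_of_ne
    · intro h; apply h1; rw [← h, Equiv.apply_symm_apply]
    · intro h; apply h2; rw [← h, Equiv.apply_symm_apply]
  set θ : Equiv.Perm (Fin N) := Equiv.swap (e q).2 (e q').2 with hθ
  have hblk₀ : (fun j => (u ∘ ⇑(Equiv.swap q q')) (e.symm ((e q).1, j))) =
      (fun j => u (e.symm ((e q).1, j))) ∘ ⇑θ := by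
    funext j
    simp only [Function.comp_apply]
    congr 1
    rcases eq_or_ne j (e q).2 with rfl | hj
    · rw [hθ, Equiv.swap_apply_left, hq, Equiv.swap_apply_left, hq']
    · rcases eq_or_ne j (e q').2 with rfl | hj'
      · rw [hθ, Equiv.swap_apply_right, hq', Equiv.swap_apply_right, hq]
      · rw [hθ, Equiv.swap_apply_of_ne_of_ne hj hj']
        exact hne _ _ (fun h => hj (congrArg Prod.snd h)) (fun h => hj' (congrArg Prod.snd h))
  have hblk : ∀ a, a ≠ (e q).1 →
      (fun j => (u ∘ ⇑(Equiv.swap q q')) (e.symm (a, j))) = fun j => u (e.symm (a, j)) := by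
    intro a ha
    funext j
    simp only [Function.comp_apply]
    congr 1
    exact hne a j (fun h => ha (congrArg Prod.fst h))
      (fun h => ha ((congrArg Prod.fst h).trans hblock.symm))
  unfold wordBlockSign
  by_cases hbij : ∀ a, Function.Bijective (fun j => u (e.symm (a, j)))
  · have hbij' : ∀ a, Function.Bijective (fun j => (u ∘ ⇑(Equiv.swap q q')) (e.symm (a, j))) := by
      intro a
      by_cases ha : a = (e q).1
      · rw [ha, hblk₀]; exact (hbij _).comp θ.bijective
      · rw [hblk a ha]; exact hbij a
    rw [if_pos hbij', if_pos hbij,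
      ← Finset.mul_prod_erase Finset.univ _ (Finset.mem_univ (e q).1),
      ← Finset.mul_prod_erase Finset.univ
        (fun a => (((Kumar2015.seqSign (fun j => u (e.symm (a, j))) : ℤˣ) : ℤ) : k))
        (Finset.mem_univ (e q).1),
      hblk₀, Kumar2015.seqSign_comp_perm (hbij _).1, hθ, Equiv.Perm.sign_swap hjj,
      Finset.prod_congr rfl fun a ha => by rw [hblk a (Finset.ne_of_mem_erase ha)]]
    push_cast
    ring
  · have hbij' : ¬ ∀ a, Function.Bijective (fun j => (u ∘ ⇑(Equiv.swap q q')) (e.symm (a, j))) := by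
      intro h
      apply hbij
      intro a
      by_cases ha : a = (e q).1
      · have := h a
        rw [ha, hblk₀] at this
        have h2 : (fun j => u (e.symm ((e q).1, j))) =
            ((fun j => u (e.symm ((e q).1, j))) ∘ ⇑θ) ∘ ⇑θ.symm := by
          funext j; simp
        rw [ha, h2]
        exact this.comp θ.symm.bijective
      · have := h a
        rwa [hblk a ha] at this
    rw [if_neg hbij', if_neg hbij, neg_zero]

omit [CharZero k] in
/-- **Re-ordering the positions inside the blocks changes the block sign by a global sign**: if two
block structures assign every position to the same block, their block signs agree up to `±1`
(BI: "`P_t` can be combinatorially defined (up to a sign) by a triple of set partitions").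
[cite: BurgisserIkenmeyer2017, Thm. 5.13 (proof)] -/
theorem wordBlockSign_eq_smul_of_blocks_eq {D b N : ℕ} (e e' : Fin D ≃ Fin b × Fin N)
    (h : ∀ q, (e q).1 = (e' q).1) :
    ∃ ε : k, ε * ε = 1 ∧ ∀ u, wordBlockSign k e' u = ε * wordBlockSign k e u := by
  classical
  -- the in-block reorderings `θ_a`
  have key : ∀ a j, e'.symm (a, j) = e.symm (a, (e (e'.symm (a, j))).2) := by
    intro a j
    apply e.injective
    rw [Equiv.apply_symm_apply]
    ext
    · rw [h, Equiv.apply_symm_apply]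
    · rfl
  have hθbij : ∀ a, Function.Bijective (fun j => (e (e'.symm (a, j))).2) := by
    intro a
    refine (Finite.injective_iff_bijective.1 fun j j' hjj' => ?_)
    have := key a j
    rw [hjj', ← key a j'] at this
    exact (Prod.ext_iff.1 (e'.symm.injective this)).2
  set θ : Fin b → Equiv.Perm (Fin N) := fun a => Equiv.ofBijective _ (hθbij a) with hθ
  refine ⟨∏ a, (((Equiv.Perm.sign (θ a) : ℤˣ) : ℤ) : k), ?_, fun u => ?_⟩
  · rw [← Finset.prod_mul_distrib]
    exact Finset.prod_eq_one fun a _ => by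
      rw [← Int.cast_mul, ← Units.val_mul, Int.units_mul_self, Units.val_one, Int.cast_one]
  · have hblk : ∀ a, (fun j => u (e'.symm (a, j))) = (fun j => u (e.symm (a, j))) ∘ ⇑(θ a) := by
      intro a; funext j
      simp only [Function.comp_apply, hθ, Equiv.ofBijective_apply]
      exact congrArg u (key a j)
    unfold wordBlockSign
    simp only [hblk]
    by_cases hbij : ∀ a, Function.Bijective (fun j => u (e.symm (a, j)))
    · have hbij' : ∀ a, Function.Bijective ((fun j => u (e.symm (a, j))) ∘ ⇑(θ a)) :=
        fun a => (hbij a).comp (θ a).bijective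
      rw [if_pos hbij', if_pos hbij, ← Finset.prod_mul_distrib]
      refine Finset.prod_congr rfl fun a _ => ?_
      rw [Kumar2015.seqSign_comp_perm (hbij a).1]
      push_cast
      ring
    · have hbij' : ¬ ∀ a, Function.Bijective ((fun j => u (e.symm (a, j))) ∘ ⇑(θ a)) := by
        intro h'
        apply hbij
        intro a
        have h2 : (fun j => u (e.symm (a, j))) =
            (((fun j => u (e.symm (a, j))) ∘ ⇑(θ a)) ∘ ⇑(θ a).symm) := by
          funext j; simp
        rw [h2]
        exact (h' a).comp (θ a).symm.bijective
      rw [if_neg hbij', if_neg hbij, mul_zero]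

/-! #### BI's invariants `P_t` of triples of wedge lists, and their symmetrisations -/

/-- **BI's invariant `P_t` of a triple `t = (e₁, e₂, e₃)` of wedge lists**, in the word model: the
product `ζ_{e₁} ⊗ ζ_{e₂} ⊗ ζ_{e₃}` of the three block signs as a function of three words ("the
combinatorial description of `P` is given by a triple `t` of wedge lists … We denote by `P_t` the
invariant corresponding to `t`"). [cite: BurgisserIkenmeyer2017, Thm. 5.13 (proof)] -/
def blockSignTriple {D b N : ℕ} (e₁ e₂ e₃ : Fin D ≃ Fin b × Fin N) (t : Word3 N D) : k :=
  wordBlockSign k e₁ t.1.1 * wordBlockSign k e₂ t.1.2 * wordBlockSign k e₃ t.2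

omit [CharZero k] in
/-- `P_t ∈ HW_□ ⊗ HW_□ ⊗ HW_□`, `□ = (b, …, b)` (`N` parts): each partial function of `P_t` is a
multiple of a block sign. [cite: BurgisserIkenmeyer2017, Thm. 5.13 (proof)] -/
theorem blockSignTriple_mem_tripleHw {D b N : ℕ} (e₁ e₂ e₃ : Fin D ≃ Fin b × Fin N) :
    blockSignTriple k e₁ e₂ e₃ ∈ tripleHw k N D
      (Weight.ofPartition N (Nat.Partition.rectangle N b))
      (Weight.ofPartition N (Nat.Partition.rectangle N b))
      (Weight.ofPartition N (Nat.Partition.rectangle N b)) := by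
  rw [mem_tripleHw_iff]
  refine ⟨fun w₂ w₃ => ?_, fun w₁ w₃ => ?_, fun w₁ w₂ => ?_⟩
  · have h : (fun w₁ => blockSignTriple k e₁ e₂ e₃ ((w₁, w₂), w₃)) =
        (wordBlockSign k e₂ w₂ * wordBlockSign k e₃ w₃) • wordBlockSign k e₁ := by
      funext w₁; simp only [blockSignTriple, Pi.smul_apply, smul_eq_mul]; ring
    rw [h]
    exact Submodule.smul_mem _ _ (wordBlockSign_mem_highestWeightSpace k _)
  · have h : (fun w₂ => blockSignTriple k e₁ e₂ e₃ ((w₁, w₂), w₃)) =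
        (wordBlockSign k e₁ w₁ * wordBlockSign k e₃ w₃) • wordBlockSign k e₂ := by
      funext w₂; simp only [blockSignTriple, Pi.smul_apply, smul_eq_mul]; ring
    rw [h]
    exact Submodule.smul_mem _ _ (wordBlockSign_mem_highestWeightSpace k _)
  · have h : (fun w₃ => blockSignTriple k e₁ e₂ e₃ ((w₁, w₂), w₃)) =
        (wordBlockSign k e₁ w₁ * wordBlockSign k e₂ w₂) • wordBlockSign k e₃ := by
      funext w₃; simp only [blockSignTriple, Pi.smul_apply, smul_eq_mul]
    rw [h]
    exact Submodule.smul_mem _ _ (wordBlockSign_mem_highestWeightSpace k _)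

omit [CharZero k] in
/-- `Ψ(τ · H) = Ψ(H)`: the symmetrisation of a translate (plumbing). [folklore] -/
private theorem sym3_comp_permute3 {N D : ℕ} (H : Word3 N D → k) (σ : Equiv.Perm (Fin D)) :
    sym3 (fun t => H (permute3 σ t)) = sym3 H := by
  funext t
  simp only [sym3, ← permute3_mul]
  exact Fintype.sum_equiv (Equiv.mulRight σ) _ _ fun τ => rfl

omit [CharZero k] in
/-- `Ψ` is additive (plumbing). [folklore] -/
private theorem sym3_add {N D : ℕ} (H H' : Word3 N D → k) : sym3 (H + H') = sym3 H + sym3 H' := by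
  funext t
  simp only [sym3, Pi.add_apply, Finset.sum_add_distrib]

omit [CharZero k] in
/-- `Ψ` is homogeneous (plumbing). [folklore] -/
private theorem sym3_smul {N D : ℕ} (c : k) (H : Word3 N D → k) : sym3 (c • H) = c • sym3 H := by
  funext t
  simp only [sym3, Pi.smul_apply, smul_eq_mul, Finset.mul_sum]

omit [CharZero k] in
/-- `Ψ 0 = 0` (plumbing). [folklore] -/
private theorem sym3_zero {N D : ℕ} : sym3 (0 : Word3 N D → k) = 0 := by
  funext t
  simp only [sym3, Pi.zero_apply, Finset.sum_const_zero]

omit [CharZero k] in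
/-- `P_{Ψ H} = D! · P_H` (the tree's `wordPoly_symFun`, zipped; plumbing). [folklore] -/
private theorem triplePoly_sym3 {N D : ℕ} (H : Word3 N D → k) :
    triplePoly (sym3 H) = (Nat.factorial D : k) • triplePoly H := by
  unfold triplePoly
  rw [sym3_comp_zip3_symm, wordPoly_symFun]

/-- **The zero pattern**: if two positions `q ≠ q'` lie in a common block of each of the three wedge
lists, then `Ψ(P_t) = 0` — "`P_t` vanishes already under the projection `½ ∑_{σ ∈ S_2} σ`, because
`½ ∑ σ P_t = ½ (P_t − P_t) = 0`" (the swap `(q q')` changes the sign of each of the three factors).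
[cite: BurgisserIkenmeyer2017, Thm. 5.13 (proof)] -/
theorem sym3_blockSignTriple_eq_zero_of_zeroPattern {D b N : ℕ} (e₁ e₂ e₃ : Fin D ≃ Fin b × Fin N)
    {q q' : Fin D} (hqq' : q ≠ q') (h₁ : (e₁ q).1 = (e₁ q').1) (h₂ : (e₂ q).1 = (e₂ q').1)
    (h₃ : (e₃ q).1 = (e₃ q').1) : sym3 (blockSignTriple k e₁ e₂ e₃) = 0 := by
  have hflip : (fun t => blockSignTriple k e₁ e₂ e₃ (permute3 (Equiv.swap q q') t)) =
      (-1 : k) • blockSignTriple k e₁ e₂ e₃ := by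
    funext t
    simp only [blockSignTriple, permute3, Pi.smul_apply, smul_eq_mul,
      wordBlockSign_comp_swap k e₁ hqq' h₁, wordBlockSign_comp_swap k e₂ hqq' h₂,
      wordBlockSign_comp_swap k e₃ hqq' h₃]
    ring
  have h := sym3_comp_permute3 k (blockSignTriple k e₁ e₂ e₃) (Equiv.swap q q')
  rw [hflip, sym3_smul, neg_one_smul] at h
  funext t
  have ht := congrFun h t
  rw [Pi.neg_apply] at ht
  rw [Pi.zero_apply]
  exact CharZero.neg_eq_self_iff.1 ht

/-! #### The cube: slices as wedge lists, `F_n = P_{ζ_x ⊗ ζ_y ⊗ ζ_z}` -/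

/-- The cube coordinates `(i, j, l) ∈ [0,n)³` of a position `p < n³` ("We fix a total ordering of
`[n]³` once and for all. This defines an ordering of each of the slices of `[n]³`").
[cite: BurgisserIkenmeyer2017, §5.1 (before eq. (5.5))] -/
def cubePos (n : ℕ) : Fin (n * n * n) ≃ Fin n × Fin n × Fin n :=
  finProdFinEquiv.symm.trans
    ((Equiv.prodCongr finProdFinEquiv.symm (Equiv.refl (Fin n))).trans
      (Equiv.prodAssoc (Fin n) (Fin n) (Fin n)))

/-- The `x`-slices of the cube as a block structure on `n³` positions: `n` blocks (the slices
`{i} × [n) × [n)`) of `n²` positions, each ordered by `finProdFinEquiv` as in BI's `xSliceMap`.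
[cite: BurgisserIkenmeyer2017, §5.1 (before eq. (5.5))] -/
def xSliceBlocks (n : ℕ) : Fin (n * n * n) ≃ Fin n × Fin (n * n) :=
  (cubePos n).trans (Equiv.prodCongr (Equiv.refl (Fin n)) finProdFinEquiv)

/-- Reordering `(i, j, l) ↦ (j, (i, l))` (plumbing). [folklore] -/
private def yShuffle (n : ℕ) : Fin n × Fin n × Fin n ≃ Fin n × Fin (n * n) where
  toFun p := (p.2.1, finProdFinEquiv (p.1, p.2.2))
  invFun q := ((finProdFinEquiv.symm q.2).1, q.1, (finProdFinEquiv.symm q.2).2)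
  left_inv p := by simp only [Equiv.symm_apply_apply]
  right_inv q := by simp only [Prod.mk.eta, Equiv.apply_symm_apply]

/-- Reordering `(i, j, l) ↦ (l, (i, j))` (plumbing). [folklore] -/
private def zShuffle (n : ℕ) : Fin n × Fin n × Fin n ≃ Fin n × Fin (n * n) where
  toFun p := (p.2.2, finProdFinEquiv (p.1, p.2.1))
  invFun q := ((finProdFinEquiv.symm q.2).1, (finProdFinEquiv.symm q.2).2, q.1)
  left_inv p := by simp only [Equiv.symm_apply_apply]
  right_inv q := by simp only [Prod.mk.eta, Equiv.apply_symm_apply]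

/-- The `y`-slices of the cube as a block structure (ordered as in BI's `ySliceMap`).
[cite: BurgisserIkenmeyer2017, §5.1 (before eq. (5.5))] -/
def ySliceBlocks (n : ℕ) : Fin (n * n * n) ≃ Fin n × Fin (n * n) := (cubePos n).trans (yShuffle n)

/-- The `z`-slices of the cube as a block structure (ordered as in BI's `zSliceMap`).
[cite: BurgisserIkenmeyer2017, §5.1 (before eq. (5.5))] -/
def zSliceBlocks (n : ℕ) : Fin (n * n * n) ≃ Fin n × Fin (n * n) := (cubePos n).trans (zShuffle n)

/-- **The cube triple tensor `ζ_x ⊗ ζ_y ⊗ ζ_z`** (`sgn_x ⊗ sgn_y ⊗ sgn_z` of eq. (5.5) as a function of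
three words on the `n³` points of the cube): BI's `P_t` for the wedge-list triple
`t₀` = (x-slices, y-slices, z-slices), which avoids the zero pattern.
[cite: BurgisserIkenmeyer2017, Thm. 5.13 (proof)] -/
def cubeSignTensor (n : ℕ) : Word3 (n * n) (n * n * n) → k :=
  blockSignTriple k (xSliceBlocks n) (ySliceBlocks n) (zSliceBlocks n)

omit [CharZero k] in
/-- `sgn_x(α)` is the `x`-slice block sign of the word `α ∘ cubePos` (plumbing). [folklore] -/
private theorem cast_labelSignX (α : Fin n × Fin n × Fin n → Fin (n * n)) :
    ((labelSignX n α : ℤ) : k) = wordBlockSign k (xSliceBlocks n) (α ∘ ⇑(cubePos n)) := by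
  have hw : ∀ ℓ, (fun j => (α ∘ ⇑(cubePos n)) ((xSliceBlocks n).symm (ℓ, j))) = xSliceMap n α ℓ := by
    intro ℓ; funext j
    simp [xSliceBlocks, xSliceMap]
  unfold labelSignX sliceSign wordBlockSign
  simp only [hw]
  split_ifs <;> simp [Int.cast_prod]

omit [CharZero k] in
/-- `sgn_y(β)` is the `y`-slice block sign (plumbing). [folklore] -/
private theorem cast_labelSignY (α : Fin n × Fin n × Fin n → Fin (n * n)) :
    ((labelSignY n α : ℤ) : k) = wordBlockSign k (ySliceBlocks n) (α ∘ ⇑(cubePos n)) := by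
  have hw : ∀ ℓ, (fun j => (α ∘ ⇑(cubePos n)) ((ySliceBlocks n).symm (ℓ, j))) = ySliceMap n α ℓ := by
    intro ℓ; funext j
    simp [ySliceBlocks, yShuffle, ySliceMap]
  unfold labelSignY sliceSign wordBlockSign
  simp only [hw]
  split_ifs <;> simp [Int.cast_prod]

omit [CharZero k] in
/-- `sgn_z(γ)` is the `z`-slice block sign (plumbing). [folklore] -/
private theorem cast_labelSignZ (α : Fin n × Fin n × Fin n → Fin (n * n)) :
    ((labelSignZ n α : ℤ) : k) = wordBlockSign k (zSliceBlocks n) (α ∘ ⇑(cubePos n)) := by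
  have hw : ∀ ℓ, (fun j => (α ∘ ⇑(cubePos n)) ((zSliceBlocks n).symm (ℓ, j))) = zSliceMap n α ℓ := by
    intro ℓ; funext j
    simp [zSliceBlocks, zShuffle, zSliceMap]
  unfold labelSignZ sliceSign wordBlockSign
  simp only [hw]
  split_ifs <;> simp [Int.cast_prod]

omit [CharZero k] in
/-- **`F_n` is the polynomial of the cube tensor**: eq. (5.5) read in the dictionary,
`F_n = P_{ζ_x ⊗ ζ_y ⊗ ζ_z}` (labelings `[n]³ → [n²]` are words on the `n³` positions; BI's variables
`w_{abc}` are the dictionary's `X_{((a,b),c)}`) — "if we contract `P_t` with a tensor `w^{⊗d}`, we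
get precisely the sum in equation (5.5)". [cite: BurgisserIkenmeyer2017, §5.1 eq. (5.5), Thm. 5.13 (proof)] -/
theorem fundInvariantTensor_eq_rename_triplePoly :
    fundInvariantTensor n k =
      rename (Equiv.prodAssoc (Fin (n * n)) (Fin (n * n)) (Fin (n * n)))
        (triplePoly (cubeSignTensor k n)) := by
  classical
  rw [fundInvariantTensor, triplePoly_eq_sum, map_sum]
  -- words ↔ labelings
  let W : (Fin n × Fin n × Fin n → Fin (n * n)) ≃ Word (n * n) (n * n * n) :=
    Equiv.arrowCongr (cubePos n).symm (Equiv.refl _)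
  have hW : ∀ α, W α = α ∘ ⇑(cubePos n) := fun α => by
    funext p; simp [W, Equiv.arrowCongr_apply]
  rw [← Fintype.sum_prod_type', ← Fintype.sum_prod_type']
  refine Fintype.sum_equiv ((W.prodCongr W).prodCongr W) _ _ fun t => ?_
  obtain ⟨⟨α, β⟩, γ⟩ := t
  simp only [Equiv.prodCongr_apply, Prod.map_apply]
  rw [map_mul, rename_C, map_prod, cubeSignTensor, blockSignTriple, Int.cast_mul, Int.cast_mul,
    cast_labelSignX, cast_labelSignY, cast_labelSignZ, hW, hW, hW]
  congr 1
  exact (Fintype.prod_equiv (cubePos n)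
    (fun q => rename (Equiv.prodAssoc (Fin (n * n)) (Fin (n * n)) (Fin (n * n)))
      (X (zip3 ((α ∘ ⇑(cubePos n), β ∘ ⇑(cubePos n)), γ ∘ ⇑(cubePos n)) q)))
    (fun p => X (α p, β p, γ p)) (fun q => by simp [zip3, rename_X])).symm

omit [CharZero k] in
/-- The cube tensor lies in `HW_□ ⊗ HW_□ ⊗ HW_□`, `□ = n² × n`.
[cite: BurgisserIkenmeyer2017, Thm. 5.13 (proof)] -/
theorem cubeSignTensor_mem_tripleHw :
    cubeSignTensor k n ∈ tripleHw k (n * n) (n * n * n)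
      (Weight.ofPartition (n * n) (Nat.Partition.rectangle (n * n) n))
      (Weight.ofPartition (n * n) (Nat.Partition.rectangle (n * n) n))
      (Weight.ofPartition (n * n) (Nat.Partition.rectangle (n * n) n)) :=
  blockSignTriple_mem_tripleHw k _ _ _

omit [CharZero k] in
/-- **Triples of wedge lists avoiding the zero pattern are renamings of the cube, up to sign**: if
no two positions share their block in all three lists `e₁, e₂, e₃` (of `n` blocks of size `n²` on
`d = n³` positions), then "No point is repeated … the point set is precisely the `n × n × n` cube",
i.e. `q ↦` (its three blocks) is a renaming `ρ ∈ S_d` of the positions carrying the blocks of `eᵢ`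
to the slices of the cube, and `P_t = ± ρ · P_{t₀}` ("these triples all coincide up to the action
of `S_d`"). [cite: BurgisserIkenmeyer2017, Thm. 5.13 (proof)] -/
theorem blockSignTriple_eq_smul_cubeSignTensor_of_injective
    (e₁ e₂ e₃ : Fin (n * n * n) ≃ Fin n × Fin (n * n))
    (hinj : Function.Injective fun q => ((e₁ q).1, (e₂ q).1, (e₃ q).1)) :
    ∃ (ρ : Equiv.Perm (Fin (n * n * n))) (ε : k), ε * ε = 1 ∧
      blockSignTriple k e₁ e₂ e₃ = ε • fun t => cubeSignTensor k n (permute3 ρ t) := by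
  -- the point-set map is a bijection onto the cube (`d = n³` points, no repetition)
  have hbij : Function.Bijective fun q => ((e₁ q).1, (e₂ q).1, (e₃ q).1) := by
    rw [Fintype.bijective_iff_injective_and_card]
    refine ⟨hinj, ?_⟩
    simp only [Fintype.card_prod, Fintype.card_fin]
    ring
  -- the renaming of the positions
  set ρ : Equiv.Perm (Fin (n * n * n)) := (Equiv.ofBijective _ hbij).trans (cubePos n).symm with hρ
  have hρ : ∀ q, cubePos n (ρ q) = ((e₁ q).1, (e₂ q).1, (e₃ q).1) := fun q => by
    simp [hρ]
  have hx : ∀ q, ((ρ.trans (xSliceBlocks n)) q).1 = (e₁ q).1 := fun q => by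
    simp [xSliceBlocks, hρ q]
  have hy : ∀ q, ((ρ.trans (ySliceBlocks n)) q).1 = (e₂ q).1 := fun q => by
    simp [ySliceBlocks, yShuffle, hρ q]
  have hz : ∀ q, ((ρ.trans (zSliceBlocks n)) q).1 = (e₃ q).1 := fun q => by
    simp [zSliceBlocks, zShuffle, hρ q]
  obtain ⟨ε₁, hε₁, h₁⟩ := wordBlockSign_eq_smul_of_blocks_eq k (ρ.trans (xSliceBlocks n)) e₁ hx
  obtain ⟨ε₂, hε₂, h₂⟩ := wordBlockSign_eq_smul_of_blocks_eq k (ρ.trans (ySliceBlocks n)) e₂ hy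
  obtain ⟨ε₃, hε₃, h₃⟩ := wordBlockSign_eq_smul_of_blocks_eq k (ρ.trans (zSliceBlocks n)) e₃ hz
  refine ⟨ρ.symm, ε₁ * ε₂ * ε₃, ?_, ?_⟩
  · calc ε₁ * ε₂ * ε₃ * (ε₁ * ε₂ * ε₃) = (ε₁ * ε₁) * (ε₂ * ε₂) * (ε₃ * ε₃) := by ring
      _ = 1 := by rw [hε₁, hε₂, hε₃, one_mul, one_mul]
  · funext t
    simp only [blockSignTriple, cubeSignTensor, Pi.smul_apply, smul_eq_mul, permute3, h₁, h₂, h₃,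
      wordBlockSign_comp_perm, Equiv.symm_symm]
    ring

/-! #### `HW_□` is spanned by the block signs; `HW ⊗ HW ⊗ HW` by the `P_t` -/

omit [CharZero k] in
/-- **Slice spaces are spanned by products**: if `Y ≤ span S` and `X ≤ span T` then every function of
two variables with all slices in `Y` resp. `X` is a linear combination of the products `y ⊗ x`,
`y ∈ S`, `x ∈ T` (the slice space is the image of `Y ⊗ X`, `exists_sliceMap_eq`; plumbing).
[folklore] -/
private theorem sliceSubmodule_le_span_image2 {α β : Type*} [Fintype α] [Fintype β]
    {Y : Submodule k (α → k)} {X : Submodule k (β → k)} {S : Set (α → k)} {T : Set (β → k)}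
    (hY : Y ≤ Submodule.span k S) (hX : X ≤ Submodule.span k T) :
    sliceSubmodule Y X ≤
      Submodule.span k (Set.image2 (fun y x => fun p : α × β => y p.1 * x p.2) S T) := by
  intro M hM
  obtain ⟨t, rfl⟩ := exists_sliceMap_eq Y X hM
  clear hM
  -- the outer product is bilinear
  let B : (α → k) →ₗ[k] (β → k) →ₗ[k] (α × β → k) :=
    LinearMap.mk₂ k (fun y x => fun p : α × β => y p.1 * x p.2)
      (fun y y' x => by funext p; simp only [Pi.add_apply]; ring)
      (fun c y x => by funext p; simp only [Pi.smul_apply, smul_eq_mul]; ring)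
      (fun y x x' => by funext p; simp only [Pi.add_apply]; ring)
      (fun c y x => by funext p; simp only [Pi.smul_apply, smul_eq_mul]; ring)
  induction t using TensorProduct.induction_on with
  | zero => rw [map_zero]; exact Submodule.zero_mem _
  | tmul y x =>
    have hB : sliceMap Y X (y ⊗ₜ x) = B (y : α → k) (x : β → k) := by
      funext p; rw [sliceMap_tmul, LinearMap.mk₂_apply]
    have h := Submodule.apply_mem_map₂ B (hY y.2) (hX x.2)
    rw [Submodule.map₂_span_span] at h
    rw [hB]
    simpa only [B, LinearMap.mk₂_apply] using h
  | add s s' hs hs' => rw [map_add]; exact Submodule.add_mem _ hs hs'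

omit [CharZero k] in
/-- **`HW_{χ₁} ⊗ HW_{χ₂} ⊗ HW_{χ₃}` is spanned by the products of spanning vectors** of the three
highest-weight spaces (the slice description of the triple tensor product, twice; plumbing).
[folklore] -/
private theorem tripleHw_le_span_of_le_span {N D : ℕ} {χ₁ χ₂ χ₃ : Weight (Fin N)}
    {S₁ S₂ S₃ : Set (Word N D → k)}
    (h₁ : highestWeightSpace (wordRep k N D) χ₁ ≤ Submodule.span k S₁)
    (h₂ : highestWeightSpace (wordRep k N D) χ₂ ≤ Submodule.span k S₂)
    (h₃ : highestWeightSpace (wordRep k N D) χ₃ ≤ Submodule.span k S₃) :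
    tripleHw k N D χ₁ χ₂ χ₃ ≤ Submodule.span k
      (Set.image2 (fun P f₃ => fun t : Word3 N D => P t.1 * f₃ t.2)
        (Set.image2 (fun f₁ f₂ => fun p : Word N D × Word N D => f₁ p.1 * f₂ p.2) S₁ S₂) S₃) :=
  sliceSubmodule_le_span_image2 k (sliceSubmodule_le_span_image2 k h₁ h₂) h₃

/-- **`HW_□((ℂ^N)^{⊗ Nb})`, `□ = (b, …, b)`, is spanned by the block signs `ζ_e`** of all block
structures `e` (`b` blocks of `N` positions) — BI: "By Schur–Weyl duality, the `S_d`-representation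
… is irreducible. Therefore, if we have a nonzero element `P`, … `{πP ∣ π ∈ S_d}` is a generating
set": the span of the `ζ_e` is a nonzero `S_{Nb}`-stable subspace (`σ · ζ_e = ζ_{σ⁻¹e}`) of the
irreducible `S_{Nb}`-module `HW_□ ≅ S^□` (the tree's `isIrreducible_hwPermRep`).
[cite: BurgisserIkenmeyer2017, Thm. 5.13 (proof)] -/
theorem highestWeightSpace_rectangle_le_span_wordBlockSign (N b : ℕ) :
    highestWeightSpace (wordRep ℂ N (N * b)) (Weight.ofPartition N (Nat.Partition.rectangle N b)) ≤
      Submodule.span ℂ (Set.range fun e : Fin (N * b) ≃ Fin b × Fin N => wordBlockSign ℂ e) := by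
  set V := highestWeightSpace (wordRep ℂ N (N * b))
    (Weight.ofPartition N (Nat.Partition.rectangle N b)) with hV
  set S : Submodule ℂ (Word N (N * b) → ℂ) :=
    Submodule.span ℂ (Set.range fun e : Fin (N * b) ≃ Fin b × Fin N => wordBlockSign ℂ e) with hS
  -- `S` is stable under the position action of `S_{Nb}`
  have hstab : ∀ (τ : Equiv.Perm (Fin (N * b))), ∀ f ∈ S, wordPerm ℂ τ f ∈ S := by
    intro τ f hf
    have hle : S.map (wordPerm ℂ τ) ≤ S := by
      rw [hS, Submodule.map_span]
      refine Submodule.span_mono ?_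
      rintro _ ⟨_, ⟨e, rfl⟩, rfl⟩
      exact ⟨τ.symm.trans e, (wordPerm_wordBlockSign ℂ e τ).symm⟩
    exact hle (Submodule.mem_map_of_mem hf)
  -- the subrepresentation `S ∩ V` of the irreducible `S_{Nb}`-module `V = HW_□`
  let W : Subrepresentation
      (hwPermRep ℂ (D := N * b) (Weight.ofPartition N (Nat.Partition.rectangle N b))) :=
    { toSubmodule := S.comap V.subtype
      apply_mem_toSubmodule := fun τ v hv => by
        rw [Submodule.mem_comap, Submodule.subtype_apply] at hv ⊢
        rw [coe_hwPermRep_apply]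
        exact hstab τ _ hv }
  haveI := _root_.Literature.RepresentationTheory.GeneralLinear.isIrreducible_hwPermRep (N := N)
    (Nat.Partition.rectangle N b) (Nat.Partition.card_parts_rectangle_le N b)
  -- a block structure, whose (nonzero) block sign lies in `W`
  let e₀ : Fin (N * b) ≃ Fin b × Fin N := finProdFinEquiv.symm.trans (Equiv.prodComm (Fin N) (Fin b))
  rcases eq_bot_or_eq_top W with hW | hW
  · exfalso
    have hW' : S.comap V.subtype = ⊥ := congrArg Subrepresentation.toSubmodule hW
    have hmem : (⟨wordBlockSign ℂ e₀, wordBlockSign_mem_highestWeightSpace ℂ e₀⟩ : V) ∈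
        S.comap V.subtype := by
      rw [Submodule.mem_comap, Submodule.subtype_apply]
      exact Submodule.subset_span ⟨e₀, rfl⟩
    rw [hW', Submodule.mem_bot] at hmem
    exact wordBlockSign_ne_zero ℂ e₀ (congrArg Subtype.val hmem)
  · intro v hv
    have hW' : S.comap V.subtype = ⊤ := congrArg Subrepresentation.toSubmodule hW
    have hmem : (⟨v, hv⟩ : V) ∈ S.comap V.subtype := by rw [hW']; exact Submodule.mem_top
    rw [Submodule.mem_comap, Submodule.subtype_apply] at hmem
    exact hmem

/-! #### `Ψ(P_{t₀}) ≠ 0`, `F_n ≠ 0`, and the discharge of Thm. 5.13 -/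

/-- **`Ψ(ζ_x ⊗ ζ_y ⊗ ζ_z) ≠ 0`** — the heart of BI's "rather indirect" proof of `F_n ≠ 0`, in the word
model: `HW_□ ⊗ HW_□ ⊗ HW_□` (`□ = n² × n`, `d = n³`) is spanned by the `P_t`
(`highestWeightSpace_rectangle_le_span_wordBlockSign`); `Ψ(P_t) = 0` for `t` with the zero
pattern, and `Ψ(P_t) = ± Ψ(P_{t₀})` otherwise (`t` is then a renaming of the cube triple `t₀`); so
if `Ψ(P_{t₀})` vanished, `Ψ` would kill `HW_□^{⊗3} ⊇ symTripleHw □ □ □`, on which `Ψ = d!`, whereas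
`dim symTripleHw □ □ □ = k_{n²}(n) = 1` (Thm. 5.9 (3), `kronRect_sq_eq_one`).
[cite: BurgisserIkenmeyer2017, Thm. 5.13 (proof)] -/
theorem sym3_cubeSignTensor_ne_zero (n : ℕ) : sym3 (cubeSignTensor ℂ n) ≠ 0 := by
  intro h0
  -- every `P_t` is killed by `Ψ`: zero pattern, or a signed renaming of the cube triple
  have hP : ∀ e₁ e₂ e₃ : Fin (n * n * n) ≃ Fin n × Fin (n * n),
      sym3 (blockSignTriple ℂ e₁ e₂ e₃) = 0 := by
    intro e₁ e₂ e₃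
    by_cases hinj : Function.Injective fun q => ((e₁ q).1, (e₂ q).1, (e₃ q).1)
    · obtain ⟨ρ, ε, -, hε⟩ :=
        blockSignTriple_eq_smul_cubeSignTensor_of_injective ℂ n e₁ e₂ e₃ hinj
      rw [hε, sym3_smul, sym3_comp_permute3, h0, smul_zero]
    · obtain ⟨q, q', hβ, hqq'⟩ := Function.not_injective_iff.1 hinj
      simp only [Prod.mk.injEq] at hβ
      exact sym3_blockSignTriple_eq_zero_of_zeroPattern ℂ e₁ e₂ e₃ hqq' hβ.1 hβ.2.1 hβ.2.2
  -- hence `Ψ` kills `HW_□ ⊗ HW_□ ⊗ HW_□`, which the `P_t` span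
  have hle := tripleHw_le_span_of_le_span ℂ
    (highestWeightSpace_rectangle_le_span_wordBlockSign (n * n) n)
    (highestWeightSpace_rectangle_le_span_wordBlockSign (n * n) n)
    (highestWeightSpace_rectangle_le_span_wordBlockSign (n * n) n)
  have hT : ∀ M ∈ tripleHw ℂ (n * n) (n * n * n)
      (Weight.ofPartition (n * n) (Nat.Partition.rectangle (n * n) n))
      (Weight.ofPartition (n * n) (Nat.Partition.rectangle (n * n) n))
      (Weight.ofPartition (n * n) (Nat.Partition.rectangle (n * n) n)), sym3 M = 0 := by
    intro M hM
    refine Submodule.span_induction (p := fun M _ => sym3 M = 0) ?_ (sym3_zero ℂ) ?_ ?_ (hle hM)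
    · rintro _ ⟨_, ⟨_, ⟨e₁, rfl⟩, _, ⟨e₂, rfl⟩, rfl⟩, _, ⟨e₃, rfl⟩, rfl⟩
      exact hP e₁ e₂ e₃
    · intro x y _ _ hx hy
      rw [sym3_add, hx, hy, add_zero]
    · intro c x _ hx
      rw [sym3_smul, hx, smul_zero]
  -- but `symTripleHw □ □ □ ≠ 0`: its dimension is `k_{n²}(n) = 1`
  have hpos : 0 < kronRect ℂ (n * n) n := by rw [kronRect_sq_eq_one]; exact Nat.one_pos
  rw [kronRect, ← finrank_symTripleHw _ _ _ (Nat.Partition.card_parts_rectangle_le _ _)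
    (Nat.Partition.card_parts_rectangle_le _ _) (Nat.Partition.card_parts_rectangle_le _ _),
    Module.finrank_pos_iff_exists_ne_zero] at hpos
  obtain ⟨⟨M, hM⟩, hM0⟩ := hpos
  obtain ⟨hM₁, hM₂⟩ := (mem_symTripleHw_iff _ _ _ _).1 hM
  have h1 := hT M hM₁
  have h2 : sym3 M = ((n * n * n).factorial : ℂ) • M := by
    funext t
    simp only [sym3, hM₂, Finset.sum_const, Finset.card_univ, Fintype.card_perm, Fintype.card_fin,
      Pi.smul_apply, smul_eq_mul, nsmul_eq_mul]
  rw [h2, smul_eq_zero] at h1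
  rcases h1 with h1 | h1
  · exact Nat.cast_ne_zero.2 (Nat.factorial_ne_zero _) h1
  · exact hM0 (Subtype.ext h1)

/-- **BI 2017, Thm. 5.13, second sentence — PROVED: "`F_n ≠ 0`"** (every `n`; print `n ≥ 1`):
`F_n = P_{t₀}` reindexed, `P_{Ψ t₀} = (n³)! · P_{t₀}`, `P` is injective on symmetric tensors, and
`Ψ(P_{t₀}) ≠ 0`. [cite: BurgisserIkenmeyer2017, Thm. 5.13] -/
theorem fundInvariantTensor_ne_zero (n : ℕ) : fundInvariantTensor n ℂ ≠ 0 := by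
  intro h
  rw [fundInvariantTensor_eq_rename_triplePoly ℂ n] at h
  have h1 : triplePoly (cubeSignTensor ℂ n) = 0 :=
    rename_injective _ (Equiv.injective _) (by rw [h, map_zero])
  have h2 : triplePoly (sym3 (cubeSignTensor ℂ n)) = 0 := by
    rw [triplePoly_sym3, h1, smul_zero]
  exact sym3_cubeSignTensor_ne_zero n
    (eq_zero_of_triplePoly_eq_zero (fun τ t => sym3_permute3 _ τ t) h2)

/-- **`O(⊗³ℂ^{n²})^{SL³}_{n³} = ℂ · F_n`** (BI: "this vector space is at most 1-dimensional with `F_n`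
being the only element up to scale"): its dimension is `k_{n²}(n) = 1`
(`finrank_sl3InvariantsOfDegree_eq_kronRect`, `kronRect_sq_eq_one`) and `0 ≠ F_n` lies in it.
[cite: BurgisserIkenmeyer2017, Thm. 5.13 (proof)] -/
theorem exists_eq_smul_fundInvariantTensor (n : ℕ)
    {F : MvPolynomial (Fin (n * n) × Fin (n * n) × Fin (n * n)) ℂ}
    (hF : F ∈ sl3InvariantsOfDegree (Fin (n * n)) ℂ (n ^ 3)) :
    ∃ c : ℂ, F = c • fundInvariantTensor n ℂ := by
  have hdim : Module.finrank ℂ (sl3InvariantsOfDegree (Fin (n * n)) ℂ (n ^ 3)) = 1 := by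
    rw [show n ^ 3 = n * n * n by ring, finrank_sl3InvariantsOfDegree_eq_kronRect,
      kronRect_sq_eq_one]
  have hnz : (⟨fundInvariantTensor n ℂ, fundInvariantTensor_mem_sl3InvariantsOfDegree n⟩ :
      sl3InvariantsOfDegree (Fin (n * n)) ℂ (n ^ 3)) ≠ 0 := fun h =>
    fundInvariantTensor_ne_zero n (congrArg Subtype.val h)
  obtain ⟨c, hc⟩ := (finrank_eq_one_iff_of_nonzero' _ hnz).1 hdim ⟨F, hF⟩
  exact ⟨c, (congrArg Subtype.val hc).symm⟩

/-- **`n³ ∈ E(n²)`** unconditionally (`F_n ≠ 0` is an `SL³`-invariant of degree `n³`; the upper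
bound `e'(n²) ≤ n` of Thm. 5.9 (3) by the printed route).
[cite: BurgisserIkenmeyer2017, Thm. 5.9 (3) and Thm. 5.13] -/
theorem cube_mem_genericTensorDegreeMonoid (n : ℕ) :
    n ^ 3 ∈ genericTensorDegreeMonoid (Fin (n * n)) ℂ :=
  cube_mem_genericTensorDegreeMonoid_of_ne_zero n (fundInvariantTensor_ne_zero n)

/-- **BI 2017, Thm. 5.13 — DISCHARGED**: "`F_n((g_1 ⊗ g_2 ⊗ g_3)w) = (det g_1 det g_2 det g_3)^n
F_n(w)` … Moreover, `F_n ≠ 0`." The semi-invariance is `fundInvariantTensor_tensorChi_pow`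
(`BI17FundamentalTensorInvariantProofs`, whence the reduction `BI2017_thm_5_13_of_ne_zero`); the
nonvanishing is `fundInvariantTensor_ne_zero` above. [cite: BurgisserIkenmeyer2017, Thm. 5.13] -/
theorem BI2017_thm_5_13_holds : BI2017_thm_5_13 :=
  BI2017_thm_5_13_of_ne_zero fun n _ => fundInvariantTensor_ne_zero n

end FundamentalInvariant

/-! ### §11 BI 2017, Rem. 5.14: noncubic formats, `k(n₂n₃ × n₁, n₁n₃ × n₂, n₁n₂ × n₃) = 1` -/

section Brick

variable (k : Type*) [Field k] [CharZero k]

/-- Partitions with the same parts have the same Young diagram (plumbing; the two may live in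
`Nat.Partition n` for syntactically different `n`). [folklore] -/
private theorem youngDiagram_eq_of_parts_eq {a b : ℕ} {μ : Nat.Partition a} {ν : Nat.Partition b}
    (h : μ.parts = ν.parts) : μ.youngDiagram = ν.youngDiagram := by
  have key : ∀ (l₁ l₂ : List ℕ) (h₁ : l₁.SortedGE) (h₂ : l₂.SortedGE), l₁ = l₂ →
      YoungDiagram.ofRowLens l₁ h₁ = YoungDiagram.ofRowLens l₂ h₂ := by
    rintro l₁ l₂ h₁ h₂ rfl; rfl
  exact key _ _ _ _ (by unfold Nat.Partition.sortedParts; rw [h])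

/-- A partition with the parts of the `a × b` rectangle has the transpose parts of the `b × a`
rectangle (plumbing). [folklore] -/
private theorem transpose_parts_of_parts_eq_rectangle {n a b : ℕ} {μ : Nat.Partition n}
    (h : μ.parts = (Nat.Partition.rectangle a b).parts) :
    μ.transpose.parts = (Nat.Partition.rectangle b a).parts := by
  rw [← Literature.Computability.Complexity.transpose_rectangle_parts]
  exact Literature.Computability.Complexity.parts_eq_of_youngDiagram_eq (by
    rw [Nat.Partition.youngDiagram_transpose, Nat.Partition.youngDiagram_transpose,
      youngDiagram_eq_of_parts_eq h])

/-- The weight of the transpose of a partition with the parts of the `a × b` rectangle, on an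
alphabet of `N` letters: `a` on the letters `< b`, `0` beyond (plumbing). [folklore] -/
private theorem ofPartition_transpose_of_parts_eq_rectangle {n a b N : ℕ} {μ : Nat.Partition n}
    (h : μ.parts = (Nat.Partition.rectangle a b).parts) (i : Fin N) :
    Weight.ofPartition N μ.transpose i = ((if (i : ℕ) < b then a else 0 : ℕ) : ℤ) := by
  simp only [Weight.ofPartition, getD_sortedParts_transpose, youngDiagram_eq_of_parts_eq h,
    colLen_youngDiagram_rectangle]

/-- The brick `[0,n₁) × [0,n₂) × [0,n₃)` is a pyramid (a down-set of `ℕ³`) (plumbing). [folklore] -/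
private theorem isPyramid_brick (n₁ n₂ n₃ : ℕ) :
    IsPyramid (Finset.range n₁ ×ˢ (Finset.range n₂ ×ˢ Finset.range n₃)) := by
  rw [isPyramid_iff]
  intro p hp q h1 h2 h3
  simp only [Finset.mem_product, Finset.mem_range] at hp ⊢
  exact ⟨lt_of_le_of_lt h1 hp.1, lt_of_le_of_lt h2 hp.2.1, lt_of_le_of_lt h3 hp.2.2⟩

/-- The brick `[0,n₁) × [0,n₂) × [0,n₃)` has the marginals of the rectangles `n₂n₃ × n₁`,
`n₁n₃ × n₂`, `n₁n₂ × n₃`: `n₂n₃` points in each of its `n₁` `x`-slices, and so on (plumbing).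
[folklore] -/
private theorem hasMarginals_brick (n₁ n₂ n₃ : ℕ) {n : ℕ} {lam mu nu : Nat.Partition n}
    (hl : lam.parts = (Nat.Partition.rectangle (n₂ * n₃) n₁).parts)
    (hm : mu.parts = (Nat.Partition.rectangle (n₁ * n₃) n₂).parts)
    (hn : nu.parts = (Nat.Partition.rectangle (n₁ * n₂) n₃).parts) :
    HasMarginals (Finset.range n₁ ×ˢ (Finset.range n₂ ×ˢ Finset.range n₃)) lam mu nu := by
  refine ⟨fun i => ?_, fun j => ?_, fun l => ?_⟩
  · rw [youngDiagram_eq_of_parts_eq hl, colLen_youngDiagram_rectangle, xMarginal]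
    split_ifs with hi
    · have h : (Finset.range n₁ ×ˢ (Finset.range n₂ ×ˢ Finset.range n₃)).filter
            (fun p : ℕ × ℕ × ℕ => p.1 = i) = {i} ×ˢ (Finset.range n₂ ×ˢ Finset.range n₃) := by
        ext p
        simp only [Finset.mem_filter, Finset.mem_product, Finset.mem_range, Finset.mem_singleton]
        constructor
        · rintro ⟨⟨-, h2, h3⟩, rfl⟩; exact ⟨rfl, h2, h3⟩
        · rintro ⟨rfl, h2, h3⟩; exact ⟨⟨hi, h2, h3⟩, rfl⟩
      rw [h]; simp [Finset.card_product]
    · rw [Finset.card_eq_zero, Finset.filter_eq_empty_iff]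
      intro p hp
      simp only [Finset.mem_product, Finset.mem_range] at hp
      rintro rfl; exact hi hp.1
  · rw [youngDiagram_eq_of_parts_eq hm, colLen_youngDiagram_rectangle, yMarginal]
    split_ifs with hj
    · have h : (Finset.range n₁ ×ˢ (Finset.range n₂ ×ˢ Finset.range n₃)).filter
            (fun p : ℕ × ℕ × ℕ => p.2.1 = j) = Finset.range n₁ ×ˢ ({j} ×ˢ Finset.range n₃) := by
        ext p
        simp only [Finset.mem_filter, Finset.mem_product, Finset.mem_range, Finset.mem_singleton]
        constructor
        · rintro ⟨⟨h1, -, h3⟩, rfl⟩; exact ⟨h1, rfl, h3⟩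
        · rintro ⟨h1, rfl, h3⟩; exact ⟨⟨h1, hj, h3⟩, rfl⟩
      rw [h]; simp [Finset.card_product]
    · rw [Finset.card_eq_zero, Finset.filter_eq_empty_iff]
      intro p hp
      simp only [Finset.mem_product, Finset.mem_range] at hp
      rintro rfl; exact hj hp.2.1
  · rw [youngDiagram_eq_of_parts_eq hn, colLen_youngDiagram_rectangle, zMarginal]
    split_ifs with hl'
    · have h : (Finset.range n₁ ×ˢ (Finset.range n₂ ×ˢ Finset.range n₃)).filter
            (fun p : ℕ × ℕ × ℕ => p.2.2 = l) = Finset.range n₁ ×ˢ (Finset.range n₂ ×ˢ {l}) := by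
        ext p
        simp only [Finset.mem_filter, Finset.mem_product, Finset.mem_range, Finset.mem_singleton]
        constructor
        · rintro ⟨⟨h1, h2, -⟩, rfl⟩; exact ⟨h1, h2, rfl⟩
        · rintro ⟨h1, h2, rfl⟩; exact ⟨⟨h1, h2, hl'⟩, rfl⟩
      rw [h]; simp [Finset.card_product]
    · rw [Finset.card_eq_zero, Finset.filter_eq_empty_iff]
      intro p hp
      simp only [Finset.mem_product, Finset.mem_range] at hp
      rintro rfl; exact hl' hp.2.2

/-- **`k(n₂n₃ × n₁, n₁n₃ × n₂, n₁n₂ × n₃) ≥ 1`**: the brick `[0,n₁) × [0,n₂) × [0,n₃)` is a pyramid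
with these marginals (the Manivel / Bürgisser–Ikenmeyer / Ikenmeyer–Mulmuley–Walter lower bound, as
in Rem. 5.10 for the cube). [cite: BurgisserIkenmeyer2017, Rem. 5.14] -/
theorem kroneckerCoeff_brick_pos (n₁ n₂ n₃ : ℕ) {n : ℕ} {lam mu nu : Nat.Partition n}
    (hl : lam.parts = (Nat.Partition.rectangle (n₂ * n₃) n₁).parts)
    (hm : mu.parts = (Nat.Partition.rectangle (n₁ * n₃) n₂).parts)
    (hn : nu.parts = (Nat.Partition.rectangle (n₁ * n₂) n₃).parts) :
    0 < kroneckerCoeff k lam mu nu :=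
  kroneckerCoeff_pos_of_isPyramid k (isPyramid_brick n₁ n₂ n₃) (hasMarginals_brick n₁ n₂ n₃ hl hm hn)

/-- **An anti-invariant triple tensor whose support configurations take their letter triples in a
set of exactly `n` triples is determined by one value** (generalising
`eq_zero_of_antiInvariant_of_apply_eq_zero` from the cube to a brick of letter triples): if
`M(τ · t) = sgn(τ) M(t)` for all `τ`, every `t` with `M(t) ≠ 0` has all its letter triples in the
image of a map `e : ι → [N)³` with `|ι| = n`, and `M` vanishes at the configuration `e ∘ f`
(`f : [n) ≃ ι`), then `M = 0` — any `t` with `M(t) ≠ 0` is injective on positions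
(`zip3_injective_of_antiInvariant_of_ne_zero`), so `t = e ∘ g` with `g : [n) → ι` injective, hence
bijective, and `t` is a position permutation of `e ∘ f`. (IMW: the `ψ_P` with `P` a point SET span the antisymmetric cube.)
[cite: IkenmeyerMulmuleyWalter2017, §2 (the vectors ψ_P)] -/
theorem eq_zero_of_antiInvariant_of_range {N n : ℕ} {ι : Type*} [Fintype ι] {M : Word3 N n → k}
    (hanti : ∀ τ t, M (permute3 τ t) = ((Equiv.Perm.sign τ : ℤ) : k) * M t)
    {e : ι → (Fin N × Fin N) × Fin N} (f : Fin n ≃ ι)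
    (hsupp : ∀ t, M t ≠ 0 → ∀ p, zip3 t p ∈ Set.range e)
    (hM : M ((zip3 (N := N) (n := n)).symm (e ∘ ⇑f)) = 0) : M = 0 := by
  funext t
  by_contra ht
  have hinj := zip3_injective_of_antiInvariant_of_ne_zero k hanti ht
  choose g hg using hsupp t ht
  have hginj : Function.Injective g := fun p q hpq => hinj (by rw [← hg p, ← hg q, hpq])
  have hgbij : Function.Bijective g := by
    rw [Fintype.bijective_iff_injective_and_card]
    exact ⟨hginj, Fintype.card_congr f⟩
  set τ : Equiv.Perm (Fin n) := (Equiv.ofBijective g hgbij).trans f.symm with hτ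
  have hperm : permute3 τ ((zip3 (N := N) (n := n)).symm (e ∘ ⇑f)) = t := by
    apply (zip3 (N := N) (n := n)).injective
    rw [zip3_permute3, Equiv.apply_symm_apply]
    funext p
    simp only [Function.comp_apply, hτ, Equiv.trans_apply, Equiv.ofBijective_apply,
      Equiv.apply_symm_apply, hg]
  have := hanti τ ((zip3 (N := N) (n := n)).symm (e ∘ ⇑f))
  rw [hperm, hM, mul_zero] at this
  exact ht this

/-- A letter occurring in a word has positive content there; so if the content of `w` at the letter
`w p` is `c` on the letters `< b` and `0` beyond, then `w p < b` (plumbing). [folklore] -/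
private theorem lt_of_wordContent_apply_eq {N n : ℕ} (w : Word N n) (p : Fin n) {b c : ℕ}
    (h : (wordContent w (w p) : ℤ) = ((if ((w p : Fin N) : ℕ) < b then c else 0 : ℕ) : ℤ)) :
    ((w p : Fin N) : ℕ) < b := by
  by_contra hb
  rw [if_neg hb, Nat.cast_zero, Nat.cast_eq_zero] at h
  unfold wordContent at h
  rw [Finset.card_eq_zero, Finset.filter_eq_empty_iff] at h
  exact h (Finset.mem_univ p) rfl

/-- **`k(n₂n₃ × n₁, n₁n₃ × n₂, n₁n₂ × n₃) ≤ 1`**: transposing two arguments, the coefficient is the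
dimension of the anti-invariant triple tensors in `HW_{(n₂n₃)^{n₁}} ⊗ HW_{(n₁n₃)^{n₂}} ⊗ HW_{(n₁n₂)^{n₃}}`
on `n₁n₂n₃` positions (`finrank_invariants_signTwist_tripleHwRep`); a configuration in the support
of such a tensor uses only letters `< n₁`, `< n₂`, `< n₃` in its three words (contents = weights,
`wordContent_eq_of_mem_tripleHw_of_ne_zero`) and carries pairwise distinct letter triples, so it is
a bijection onto the brick and the tensor is determined by one value
(`eq_zero_of_antiInvariant_of_range`) — the upper bound `k ≤ t` of Ikenmeyer–Mulmuley–Walter /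
Bürgisser–Ikenmeyer for the brick, whose only point set is the brick itself.
[cite: BurgisserIkenmeyer2017, Rem. 5.14] -/
theorem kroneckerCoeff_brick_le_one (n₁ n₂ n₃ : ℕ) {n : ℕ} {lam mu nu : Nat.Partition n}
    (hl : lam.parts = (Nat.Partition.rectangle (n₂ * n₃) n₁).parts)
    (hm : mu.parts = (Nat.Partition.rectangle (n₁ * n₃) n₂).parts)
    (hn : nu.parts = (Nat.Partition.rectangle (n₁ * n₂) n₃).parts) :
    kroneckerCoeff k lam mu nu ≤ 1 := by
  classical
  -- the size `n = n₁ n₂ n₃`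
  have hsum : n = n₂ * n₃ * n₁ := by
    have h := lam.parts_sum
    rw [hl, (Nat.Partition.rectangle (n₂ * n₃) n₁).parts_sum] at h
    exact h.symm
  -- the alphabet: `N = n₁ + n₂ + n₃` letters suffice for the three transposed rectangles
  set N : ℕ := n₁ + n₂ + n₃ with hN
  have hN₁ : n₁ ≤ N := by omega
  have hN₂ : n₂ ≤ N := by omega
  have hN₃ : n₃ ≤ N := by omega
  have hT₁ : lam.transpose.parts.card ≤ N := by
    rw [transpose_parts_of_parts_eq_rectangle hl]
    exact (Nat.Partition.card_parts_rectangle_le _ _).trans hN₁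
  have hT₂ : mu.transpose.parts.card ≤ N := by
    rw [transpose_parts_of_parts_eq_rectangle hm]
    exact (Nat.Partition.card_parts_rectangle_le _ _).trans hN₂
  have hT₃ : nu.transpose.parts.card ≤ N := by
    rw [transpose_parts_of_parts_eq_rectangle hn]
    exact (Nat.Partition.card_parts_rectangle_le _ _).trans hN₃
  have hdim := finrank_invariants_signTwist_tripleHwRep (k := k) (N := N) lam.transpose
    mu.transpose nu.transpose hT₁ hT₂ hT₃
  rw [Nat.Partition.transpose_transpose, ← kroneckerCoeff_transpose₁₂] at hdim
  rw [← hdim]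
  -- the brick of letter triples and a reference configuration
  let e : Fin n₁ × Fin n₂ × Fin n₃ → (Fin N × Fin N) × Fin N := fun q =>
    ((Fin.castLE hN₁ q.1, Fin.castLE hN₂ q.2.1), Fin.castLE hN₃ q.2.2)
  have hcard : Fintype.card (Fin n) = Fintype.card (Fin n₁ × Fin n₂ × Fin n₃) := by
    simp only [Fintype.card_prod, Fintype.card_fin, hsum]
    ring
  let f : Fin n ≃ Fin n₁ × Fin n₂ × Fin n₃ := Fintype.equivOfCardEq hcard
  set t₀ : Word3 N n := (zip3 (N := N) (n := n)).symm (e ∘ ⇑f) with ht₀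
  -- evaluation at `t₀`, an injective linear functional on the anti-invariants
  refine le_trans (LinearMap.finrank_le_finrank_of_injective
    (f := (LinearMap.proj t₀).comp ((Submodule.subtype _).comp (Submodule.subtype _))) ?_) ?_
  · intro x y hxy
    simp only [LinearMap.coe_comp, Function.comp_apply, Submodule.coe_subtype, LinearMap.proj_apply]
      at hxy
    rw [← sub_eq_zero]
    set z := x - y with hz
    set Mz : Word3 N n → k := ((z : tripleHw k N n
      (Weight.ofPartition N lam.transpose) (Weight.ofPartition N mu.transpose)
      (Weight.ofPartition N nu.transpose)) : Word3 N n → k) with hMz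
    have hz' : Mz t₀ = 0 := by
      rw [hMz, hz, Submodule.coe_sub, Submodule.coe_sub, Pi.sub_apply, hxy, sub_self]
    have hanti : ∀ τ t, Mz (permute3 τ t) = ((Equiv.Perm.sign τ : ℤ) : k) * Mz t := by
      intro τ t
      have hinv := (Representation.mem_invariants _ _).1 z.2 τ
      rw [signTwist_apply, LinearMap.smul_apply] at hinv
      have := congrArg (fun y : tripleHw k N n (Weight.ofPartition N lam.transpose)
        (Weight.ofPartition N mu.transpose) (Weight.ofPartition N nu.transpose) =>
          (y : Word3 N n → k) t) hinv
      simp only [Submodule.coe_smul_of_tower, Pi.smul_apply, coe_tripleHwRep_apply, smul_eq_mul]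
        at this
      have hs := sign_cast_mul_self (k := k) τ
      have e : Mz (permute3 τ t) = ((Equiv.Perm.sign τ : ℤ) : k) *
          (((Equiv.Perm.sign τ : ℤ) : k) * Mz (permute3 τ t)) := by
        rw [← mul_assoc, hs, one_mul]
      rw [e, this]
    -- support configurations take their letter triples in the brick
    have hsupp : ∀ t, Mz t ≠ 0 → ∀ p, zip3 t p ∈ Set.range e := by
      intro t ht p
      obtain ⟨h1, -, -⟩ := wordContent_eq_of_mem_tripleHw_of_ne_zero k z.1.2 ht (t.1.1 p)
      obtain ⟨-, h2, -⟩ := wordContent_eq_of_mem_tripleHw_of_ne_zero k z.1.2 ht (t.1.2 p)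
      obtain ⟨-, -, h3⟩ := wordContent_eq_of_mem_tripleHw_of_ne_zero k z.1.2 ht (t.2 p)
      rw [ofPartition_transpose_of_parts_eq_rectangle hl] at h1
      rw [ofPartition_transpose_of_parts_eq_rectangle hm] at h2
      rw [ofPartition_transpose_of_parts_eq_rectangle hn] at h3
      refine ⟨(⟨(t.1.1 p : ℕ), lt_of_wordContent_apply_eq t.1.1 p h1⟩,
        ⟨(t.1.2 p : ℕ), lt_of_wordContent_apply_eq t.1.2 p h2⟩,
        ⟨(t.2 p : ℕ), lt_of_wordContent_apply_eq t.2 p h3⟩), rfl⟩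
    have h0 : Mz = 0 := eq_zero_of_antiInvariant_of_range k hanti f hsupp hz'
    apply Subtype.ext
    apply Subtype.ext
    exact h0
  · rw [Module.finrank_self]

/-- **BI 2017, Rem. 5.14 (noncubic formats) — the Kronecker coefficient, PROVED:
`k(n₂n₃ × n₁, n₁n₃ × n₂, n₁n₂ × n₃) = 1`** for all `n₁, n₂, n₃` ("Let `n₁, n₂, n₃ ≥ 1`. We know
from [Ike12b] that `k(n₂n₃ × n₁, n₁n₃ × n₂, n₁n₂ × n₃) = 1`"; `a × b` = `a` parts equal to `b`, the
tree's `Nat.Partition.rectangle a b`; the three partitions are taken in a common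
`Nat.Partition n`, `n = n₁n₂n₃`, through their parts). Proof: the brick `[n₁] × [n₂] × [n₃]` is the
only point set, and a pyramid, with these marginals (Ikenmeyer–Mulmuley–Walter bounds, as for
`kronRect_sq_eq_one` = the cube case `n₁ = n₂ = n₃`, Thm. 5.9 (3)). The corresponding invariant
`F_{n₁n₂n₃}` of degree `n₁n₂n₃` on `ℂ^{n₂n₃} ⊗ ℂ^{n₁n₃} ⊗ ℂ^{n₁n₂}` is not typed.
-- TODO(general form): `F_{n₁n₂n₃}` by (5.5) over labelings of `[n₁] × [n₂] × [n₃]`, and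
-- `F_{n11}(w) = n! det(w)`.
[cite: BurgisserIkenmeyer2017, Rem. 5.14] -/
theorem kroneckerCoeff_brick_eq_one (n₁ n₂ n₃ : ℕ) {n : ℕ} {lam mu nu : Nat.Partition n}
    (hl : lam.parts = (Nat.Partition.rectangle (n₂ * n₃) n₁).parts)
    (hm : mu.parts = (Nat.Partition.rectangle (n₁ * n₃) n₂).parts)
    (hn : nu.parts = (Nat.Partition.rectangle (n₁ * n₂) n₃).parts) :
    kroneckerCoeff k lam mu nu = 1 :=
  le_antisymm (kroneckerCoeff_brick_le_one k n₁ n₂ n₃ hl hm hn)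
    (kroneckerCoeff_brick_pos k n₁ n₂ n₃ hl hm hn)

/-- The cube case `n₁ = n₂ = n₃ = n` of Rem. 5.14 is Thm. 5.9 (3), `k_{n²}(n) = 1`
(`kronRect_sq_eq_one`, recovered). [cite: BurgisserIkenmeyer2017, Rem. 5.14] -/
theorem kronRect_sq_eq_one' (n : ℕ) : kronRect k (n * n) n = 1 :=
  kroneckerCoeff_brick_eq_one k n n n rfl rfl rfl

end Brick

end Literature.Computability.AlgebraicComplexity
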